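import Mathlib.Analysis.Calculus.BumpFunction.InnerProduct
import Literature.Analysis.FluidPDE.DistributionalPressurePoisson
import Literature.Analysis.FluidPDE.NSSliceTimePairing
import HarnessLib

/-!
# Chae's Liouville theorem and equipartition of energy for weak solutions of the Euler and
# Navier–Stokes equations with integrable pressure

Analysis/FluidPDE file (all results proved; no definitions, no named facts). Source:
D. Chae, *Liouville type theorems for the Euler and the Navier–Stokes equations*, Adv. Math.
228 (2011) 2855–2868 (= arXiv:0809.0743), Theorem 1.1 [Chae2011]:

  "Let `(v, p)` be a weak solution to `(NS)_ν` with `ν ≥ 0` [on `ℝ^N × (0, T)`, Definition 1.1: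
  the momentum equation tested with `φ(x)ξ(t)`, `ξ ∈ C¹_0(0, T)`, `φ ∈ C_0^∞(ℝ^N)^N`, and
  `div v = 0` in the sense of distributions].
  (i) (Liouville type of property) Suppose `p ∈ L¹_+(0, T; L¹(ℝ^N))` [i.e. `p ∈ L¹(0,T; L¹)`
  with `∫ p(x, t) dx ≥ 0` a.e. `t`], or `p ∈ L¹(0, T; ℋ^q(ℝ^N))` for some `q ∈ (0, 1]`
  [Hardy space]. Then `v = 0` on `ℝ^N × (0, T)`.
  (ii) (Equipartition of energy) Suppose `p ∈ L¹_-(0, T; L¹(ℝ^N))`. Then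
  `ℰ_1(t) = ⋯ = ℰ_N(t) = -½ ∫ p(x, t) dx` and `∫ v^j v^k dx = 0` for all `j ≠ k`, for almost
  every `t ∈ (0, T)`" (`ℰ_j(t) = ½ ∫ (v^j)²`).

The printed proof (§2, (21)–(26)) tests the equations with the gradient fields
`φ = ∇(R² Ψ(x/R))`, `Ψ(x) = ½ x_j² σ(x)` resp. `x_j x_k σ(x)` (`σ` a cut-off, `= 1` on `B₁`,
`= 0` off `B₂`): the time-derivative and the viscous terms vanish on gradients of test functions
by the distributional divergence-free condition, the surviving identity is
`∫∫ ξ(t) (D²Ψ(x/R)(v, v) + p ΔΨ(x/R)) dx dt = 0`, and dominated convergence as `R → ∞`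
(`|v|², p ∈ L¹`) gives `∫∫ ξ(t) (D²Ψ(0)(v, v) + ΔΨ(0) p) = 0` for every `ξ`, whence the slice
identities for a.e. `t`.

## What is proved, and in which form

We follow the printed proof verbatim, for the tree's pressure-explicit distributional solutions
`IsDistributionalNSSolutionOn (slab E I hI) ν 0 u p` (Caffarelli–Kohn–Nirenberg form: `u`,
`|u|²`, `p` locally integrable, `div u = 0` weakly, momentum equation against every
`ψ ∈ C_c^∞(I × E; E)`), on a slab `I × E` over an arbitrary open set of times `I` and a
finite-dimensional real inner product space `E` (the source: `I = (0, T)`, `E = ℝ^N`), for every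
`ν ∈ ℝ` (the source: `ν ≥ 0`; the sign is not used). The first step of the printed proof — testing
with a gradient field kills `∂ₜ` and `νΔ` — is the tree's
`IsDistributionalNSSolutionOn.integral_hessian_add_pressure_laplacian_eq_zero`
(`DistributionalPressurePoisson.lean`), which we invoke instead of re-deriving (21).

* `IsDistributionalNSSolutionOn.ae_integral_hessian_add_laplacian_mul_integral_pressure_eq_zero`
  — the master identity behind (111)–(112): for every `Ψ ∈ C_c^∞(E)`,
  `∫ D²Ψ(0)(u(t), u(t)) dx + ΔΨ(0) ∫ p(t) dx = 0` for a.e. `t ∈ I`;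
* `IsDistributionalNSSolutionOn.ae_integral_inner_mul_inner_eq` — Theorem 1.1 (ii) in bilinear
  form: `∫ ⟪a, u(t)⟫⟪b, u(t)⟫ dx = -⟪a, b⟫ ∫ p(t) dx` for a.e. `t` (with `a = b = e_j`:
  `ℰ_j(t) = -½∫p`, (111); with `a = e_j ⊥ b = e_k`: `∫ v^j v^k = 0`, (112));
* `IsDistributionalNSSolutionOn.ae_integral_norm_sq_eq` — the summed form
  `∫ |u(t)|² dx = -N ∫ p(t) dx`, `N = dim E`;
* `IsDistributionalNSSolutionOn.ae_eq_zero_of_integral_pressure_nonneg` — Theorem 1.1 (i):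
  if `∫ p(t) dx ≥ 0` for a.e. `t`, then `u = 0` a.e. on `I × E`;
* `chae2011_thm11_i`, `chae2011_thm11_ii` — the printed instances `I = (0, T)`;
* (section `Weighted`, the companion paper D. Chae, *Liouville type of theorems with weights for
  the Navier–Stokes and the Euler equations*, arXiv:0811.4647, Thm 1.1, whose proof tests with
  `∇(W(|x|) σ_R)` instead of `∇(R²Ψ(x/R))`)
  `IsDistributionalNSSolutionOn.ae_integral_hessian_apply_add_integral_pressure_mul_laplacian_eq_zero`
  — **the weighted identity** for an arbitrary smooth weight `Φ` of controlled growth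
  (`|D²Φ(x)(v,v)| ≤ w(x)|v|²` with `|u|²w, |p|w, |u|²|∇Φ|/(1+|x|), |p||∇Φ|/(1+|x|),
  |u|²|Φ|/(1+|x|)², |p||Φ|/(1+|x|)²` integrable on the slab):
  `∫ D²Φ(x)(u(t), u(t)) dx + ∫ p(t) ΔΦ dx = 0` for a.e. `t` (product rule
  `D²(σ_RΦ) = σ_R D²Φ + 2∇σ_R ⊗ ∇Φ + Φ D²σ_R`, shell bounds `|∇σ_R| ≤ 4K₁/(1+|x|)`,
  `|D²σ_R| ≤ 16K₂/(1+|x|)²`, dominated convergence), and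
  `IsDistributionalNSSolutionOn.ae_slice_eq_zero_of_convex_weight` — the Liouville conclusion for
  a uniformly-in-direction strictly convex weight (`κ(x)|v|² ≤ D²Φ(x)(v,v)`, `κ > 0`) under the
  sign hypothesis `∫ p(t) ΔΦ ≥ 0`: `u(t, ·) = 0` a.e. for a.e. `t` (Chae's `Φ = W(|x|)`,
  `W'' = w > 0`, is the radial instance; the radial Hessian formula is not expanded here).
  `chae2008_thm12_bracketWeight` — **Chae 2008 Thm 1.2 for the admissible weight
  `w(r) = (1+r²)^{-3/2}`** (`Φ = ⟨x⟩ = √(1+|x|²)`): `|u|²/(1+|x|), |p|/(1+|x|) ∈ L¹(I × E)` and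
  `∫ p(t)[(N−1)⟨x⟩⁻¹ + ⟨x⟩⁻³] ≥ 0` a.e. `t` ⇒ `u(t,·) = 0` a.e. for a.e. `t`.
  -- TODO(general form): the radial bookkeeping `D²(W∘|·|)` of arXiv:0811.4647 Thm 1.1–1.2
  -- for a general weight `w`.

Hypotheses. The source's Definition 1.1 asks `v ∈ L¹(0, T; L²_σ)` and Theorem 1.1 asks
`p ∈ L¹(0, T; L¹)`; the printed proof (§2 (a), the dominated-convergence step for `I₁`:
"`|g_R(t)| ≤ g(t) := ∫ (v_1)² dx` with `g ∈ L¹(0, T)`") uses `|v|² ∈ L¹(ℝ^N × (0, T))`, and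
this — `|u|², p` integrable on the slab — is what is assumed here. The Hardy-space alternative
of (i) (`p ∈ L¹(0, T; ℋ^q)`, `0 < q ≤ 1`, §2 (b); Remark 1.1) and the MHD version (Theorem 3.1)
are not rendered (no Hardy spaces `ℋ^q(ℝ^N)` in Mathlib).
-- TODO(general form): Thm 1.1 (i) under `p ∈ L¹(0,T; ℋ^q(ℝ^N))`, and Thm 3.1 (MHD).

## References

* D. Chae, *Liouville type theorems for the Euler and the Navier–Stokes equations*, Adv. Math.
  228 (2011) 2855–2868, Thm 1.1 and §2; arXiv:0809.0743. [Chae2011]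
* D. Chae, *Liouville type of theorems with weights for the Navier–Stokes equations and the
  Euler equations*, arXiv:0811.4647 (2008), Thm 1.1 and its proof in §2 (published form:
  Differential Integral Equations 23 (2010)). [Chae2008Weighted]
* P. G. Lemarié-Rieusset, *The Navier–Stokes Problem in the 21st Century* (2016), (13.19)
  (the gradient-test-field identity, tree file `DistributionalPressurePoisson`).
-/

noncomputable section

open MeasureTheory Set Function Filter Topology TopologicalSpace InnerProductSpace Metric
open scoped Laplacian RealInnerProductSpace NNReal ENNReal ContDiff

namespace Literature.Analysis.FluidPDE

variable {E : Type*} [NormedAddCommGroup E] [InnerProductSpace ℝ E] [FiniteDimensional ℝ E]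
  [MeasurableSpace E] [BorelSpace E]

/-! ### Dilation calculus for the cut-off profiles `x ↦ R² Ψ(x/R)` -/

namespace Chae2011

section Dilation

variable {F : Type*} [NormedAddCommGroup F] [NormedSpace ℝ F]

omit [FiniteDimensional ℝ E] [MeasurableSpace E] [BorelSpace E] in
/-- `D(k • f(c ·))(x) = (k c) • Df(c x)` for all `k c : ℝ`, with no differentiability hypothesis
(Mathlib's `fderiv_comp_smul`, `fderiv_const_smul_field`; general-`E` form of the tree's
`ℝ³` lemma in `FlatSwirlGauge`). [folklore] -/
private theorem fderiv_const_smul_comp_smul_apply (f : E → F) (k c : ℝ) (x : E) :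
    fderiv ℝ (fun y => k • f (c • y)) x = (k * c) • fderiv ℝ f (c • x) := by
  have h : (fun y => k • f (c • y)) = k • fun y => f (c • y) := rfl
  rw [h, fderiv_const_smul_field, Pi.smul_apply, _root_.fderiv_comp_smul, smul_smul]

omit [FiniteDimensional ℝ E] [MeasurableSpace E] [BorelSpace E] in
/-- **The Hessian of the parabolic dilation** `x ↦ R² f(x/R)` is `D²f(x/R)` (`R ≠ 0`), with no
differentiability hypothesis. [folklore] -/
private theorem fderiv_fderiv_dilate (f : E → F) {R : ℝ} (hR : R ≠ 0) :
    fderiv ℝ (fderiv ℝ fun y => R ^ 2 • f (R⁻¹ • y)) =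
      fun x => fderiv ℝ (fderiv ℝ f) (R⁻¹ • x) := by
  have h1 : (fderiv ℝ fun y => R ^ 2 • f (R⁻¹ • y)) = fun x => R • fderiv ℝ f (R⁻¹ • x) := by
    funext x
    rw [fderiv_const_smul_comp_smul_apply, pow_two, mul_assoc, mul_inv_cancel₀ hR, mul_one]
  rw [h1]
  funext x
  rw [fderiv_const_smul_comp_smul_apply (fderiv ℝ f) R R⁻¹ x, mul_inv_cancel₀ hR, one_smul]

omit [FiniteDimensional ℝ E] [MeasurableSpace E] [BorelSpace E] in
/-- `D²(c • f) = c • D²f`, with no differentiability hypothesis (field scalars). [folklore] -/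
private theorem fderiv_fderiv_const_smul (f : E → F) (c : ℝ) :
    fderiv ℝ (fderiv ℝ (c • f)) = c • fderiv ℝ (fderiv ℝ f) := by
  rw [fderiv_const_smul_field c (f := f)]
  exact fderiv_const_smul_field (f := fderiv ℝ f) c

omit [MeasurableSpace E] [BorelSpace E] in
/-- `Δ f(x) = Σᵢ D²f(x)(eᵢ, eᵢ)` in the standard orthonormal frame (Mathlib's formula through
`iteratedFDeriv_two_apply`). [folklore] -/
private theorem laplacian_eq_sum_fderiv_fderiv (f : E → F) (x : E) :
    Δ f x = ∑ i, fderiv ℝ (fderiv ℝ f) x (stdOrthonormalBasis ℝ E i)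
      (stdOrthonormalBasis ℝ E i) := by
  rw [laplacian_eq_iteratedFDeriv_stdOrthonormalBasis]
  simp only [iteratedFDeriv_two_apply]
  rfl

omit [MeasurableSpace E] [BorelSpace E] in
/-- **Laplacian of the parabolic dilation**: `Δ(R² f(·/R))(x) = (Δ f)(x/R)`, `R ≠ 0`. [folklore] -/
private theorem laplacian_dilate (f : E → F) {R : ℝ} (hR : R ≠ 0) (x : E) :
    Δ (fun y => R ^ 2 • f (R⁻¹ • y)) x = Δ f (R⁻¹ • x) := by
  rw [laplacian_eq_sum_fderiv_fderiv, laplacian_eq_sum_fderiv_fderiv, fderiv_fderiv_dilate f hR]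

omit [MeasurableSpace E] [BorelSpace E] in
/-- `Δ(c • f) = c • Δ f` pointwise, with no differentiability hypothesis. [folklore] -/
private theorem laplacian_const_smul (f : E → F) (c : ℝ) (x : E) : Δ (c • f) x = c • Δ f x := by
  rw [laplacian_eq_sum_fderiv_fderiv, laplacian_eq_sum_fderiv_fderiv, fderiv_fderiv_const_smul,
    Finset.smul_sum]
  rfl

omit [FiniteDimensional ℝ E] [MeasurableSpace E] [BorelSpace E] in
/-- The dilated profile `x ↦ R² Ψ(x/R)` of a smooth compactly supported `Ψ` is a test function
on `E`. [folklore] -/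
private theorem isTestFunctionOn_dilate {Ψ : E → F} (hΨ : ContDiff ℝ ∞ Ψ) (hΨc : HasCompactSupport Ψ)
    {R : ℝ} (hR : R ≠ 0) :
    FunctionSpaces.IsTestFunctionOn (⟨univ, isOpen_univ⟩ : Opens E)
      (fun y => R ^ 2 • Ψ (R⁻¹ • y)) where
  contDiff := contDiff_const.smul (hΨ.comp (contDiff_const_smul R⁻¹))
  hasCompactSupport := by
    have h : HasCompactSupport fun y => Ψ (R⁻¹ • y) := hΨc.comp_smul (inv_ne_zero hR)
    exact h.smul_left
  tsupport_subset := fun _ _ => mem_univ _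

end Dilation

/-! ### The two quadratic profiles and their Hessian / Laplacian at the origin -/

section Profiles

omit [MeasurableSpace E] [BorelSpace E] [FiniteDimensional ℝ E] in
/-- `D²(⟪a, ·⟫⟪b, ·⟫)(x)(v, v) = 2 ⟪a, v⟫⟪b, v⟫`. [folklore] -/
private theorem fderiv_fderiv_inner_mul_inner (a b x v : E) :
    fderiv ℝ (fderiv ℝ fun y => ⟪a, y⟫ * ⟪b, y⟫) x v v = 2 * (⟪a, v⟫ * ⟪b, v⟫) := by
  have h1 : (fderiv ℝ fun y => ⟪a, y⟫ * ⟪b, y⟫) = fun y =>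
      ((innerSL ℝ a).smulRight (innerSL ℝ b) + (innerSL ℝ b).smulRight (innerSL ℝ a) :
        E →L[ℝ] (E →L[ℝ] ℝ)) y := by
    funext y
    have h : HasFDerivAt (fun z => ⟪a, z⟫ * ⟪b, z⟫)
        (⟪a, y⟫ • innerSL ℝ b + ⟪b, y⟫ • innerSL ℝ a) y :=
      ((innerSL ℝ a).hasFDerivAt (x := y)).fun_mul ((innerSL ℝ b).hasFDerivAt (x := y))
    rw [h.fderiv]
    rfl
  rw [h1, ContinuousLinearMap.fderiv]
  change ⟪a, v⟫ * ⟪b, v⟫ + ⟪b, v⟫ * ⟪a, v⟫ = _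
  ring

omit [MeasurableSpace E] [BorelSpace E] [FiniteDimensional ℝ E] in
/-- `D²(‖·‖²)(x)(v, v) = 2 ‖v‖²`. [folklore] -/
private theorem fderiv_fderiv_norm_sq (x v : E) :
    fderiv ℝ (fderiv ℝ fun y : E => ‖y‖ ^ 2) x v v = 2 * ‖v‖ ^ 2 := by
  have h1 : (fderiv ℝ fun y : E => ‖y‖ ^ 2) = fun y =>
      ((2 : ℝ) • (innerSL ℝ : E →L[ℝ] E →L[ℝ] ℝ)) y := by
    funext y
    rw [(hasStrictFDerivAt_norm_sq y).hasFDerivAt.fderiv]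
    ext w
    change ((2 : ℕ) • innerSL ℝ y) w = (2 : ℝ) * ⟪y, w⟫
    rw [two_nsmul, two_mul]
    rfl
  rw [h1, ContinuousLinearMap.fderiv]
  change (2 : ℝ) * ⟪v, v⟫ = _
  rw [real_inner_self_eq_norm_sq]

omit [MeasurableSpace E] [BorelSpace E] in
/-- `Δ(⟪a, ·⟫⟪b, ·⟫) = 2 ⟪a, b⟫` (Parseval in the standard frame). [folklore] -/
private theorem laplacian_inner_mul_inner (a b x : E) :
    Δ (fun y => ⟪a, y⟫ * ⟪b, y⟫) x = 2 * ⟪a, b⟫ := by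
  rw [laplacian_eq_sum_fderiv_fderiv]
  simp_rw [fderiv_fderiv_inner_mul_inner, ← Finset.mul_sum]
  congr 1
  rw [← (stdOrthonormalBasis ℝ E).sum_inner_mul_inner a b]
  exact Finset.sum_congr rfl fun i _ => by rw [real_inner_comm b]

omit [MeasurableSpace E] [BorelSpace E] in
/-- `Δ(‖·‖²) = 2 N`, `N = dim E`. [folklore] -/
private theorem laplacian_norm_sq (x : E) :
    Δ (fun y : E => ‖y‖ ^ 2) x = 2 * Module.finrank ℝ E := by
  rw [laplacian_eq_sum_fderiv_fderiv]
  simp_rw [fderiv_fderiv_norm_sq, (stdOrthonormalBasis ℝ E).orthonormal.1, one_pow, mul_one]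
  simp only [Finset.sum_const, Finset.card_univ, Fintype.card_fin, nsmul_eq_mul]
  ring

end Profiles

end Chae2011

/-! ### The master identity: testing with `ξ(t) R² Ψ(x/R)` and letting `R → ∞` -/

section Main

variable {I : Set ℝ} {hI : IsOpen I} {ν : ℝ} {u : ℝ → E → E} {p : ℝ → E → ℝ}

/-- **Chae's identity** (Chae 2011, proof of Thm 1.1, (21)–(24) with `R → ∞`). Let `(u, p)` be a
distributional solution of the Navier–Stokes (`ν ≠ 0`) or Euler (`ν = 0`) equations on the slab
`I × E` (`I ⊆ ℝ` open, `E` a finite-dimensional real inner product space) with `|u|²` and `p`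
integrable on `I × E`. Then for every `Ψ ∈ C_c^∞(E)` and almost every `t ∈ I`,
`∫ D²Ψ(0)(u(t,x), u(t,x)) dx + ΔΨ(0) ∫ p(t,x) dx = 0`.
Proof as printed: the momentum equation tested with `∇(ξ(t) R²Ψ(x/R))` reduces (time-derivative
and viscous terms vanish on gradients, `div u = 0`) to `∫∫ ξ (D²Ψ(x/R)(u,u) + p ΔΨ(x/R)) = 0`;
dominated convergence (`R → ∞`), Fubini and du Bois-Reymond in `t`. [cite: Chae2011, Thm 1.1 (proof, §2 (21)–(24))] -/
theorem IsDistributionalNSSolutionOn.ae_integral_hessian_add_laplacian_mul_integral_pressure_eq_zero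
    (hsol : IsDistributionalNSSolutionOn (slab E I hI) ν 0 u p)
    (hu2 : IntegrableOn (fun z : ℝ × E => ‖u z.1 z.2‖ ^ 2) (I ×ˢ univ) volume)
    (hp : IntegrableOn (uncurry p) (I ×ˢ univ) volume)
    {Ψ : E → ℝ} (hΨ : ContDiff ℝ ∞ Ψ) (hΨc : HasCompactSupport Ψ) :
    ∀ᵐ t ∂(volume.restrict I),
      (∫ x, fderiv ℝ (fderiv ℝ Ψ) 0 (u t x) (u t x)) + Δ Ψ 0 * ∫ x, p t x = 0 := by
  set D2 : E → E →L[ℝ] E →L[ℝ] ℝ := fderiv ℝ (fderiv ℝ Ψ) with hD2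
  set L : E → ℝ := Δ Ψ with hL
  set b := stdOrthonormalBasis ℝ E with hb
  -- coefficient expansion of a bilinear form in the orthonormal frame `b`
  have hexp : ∀ (B : E →L[ℝ] E →L[ℝ] ℝ) (v : E),
      B v v = ∑ i, ∑ j, (⟪b i, v⟫ * ⟪b j, v⟫) * B (b i) (b j) := by
    intro B v
    conv_lhs => rw [← b.sum_repr' v]
    simp only [map_sum, map_smul, FunLike.coe_sum, Finset.sum_apply, FunLike.coe_smul,
      Pi.smul_apply, smul_eq_mul, Finset.mul_sum]
    rw [Finset.sum_comm]
    refine Finset.sum_congr rfl fun i _ => Finset.sum_congr rfl fun j _ => ?_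
    ring
  -- regularity and uniform bounds of `D²Ψ` and `ΔΨ`, through scalar coefficient functions
  have hΨ3 : ContDiff ℝ 3 Ψ := contDiff_infty.1 hΨ 3
  have hD1 : ContDiff ℝ 2 (fderiv ℝ Ψ) := hΨ3.fderiv_right (m := 2) le_rfl
  have hD2c := hD1.continuous_fderiv (by simp)
  have hD2cs : HasCompactSupport D2 := (hΨc.fderiv (𝕜 := ℝ)).fderiv (𝕜 := ℝ)
  have hAc : ∀ i j, Continuous fun y => D2 y (b i) (b j) := fun i j =>
    (hD2c.clm_apply continuous_const).clm_apply continuous_const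
  have hAcs : ∀ i j, HasCompactSupport fun y => D2 y (b i) (b j) := fun i j =>
    hD2cs.mono fun y hy => by
      rw [mem_support] at hy ⊢
      intro h0
      apply hy
      simp [h0]
  choose K hK using fun i j => (hAc i j).bounded_above_of_compact_support (hAcs i j)
  have hKnn : ∀ i j, 0 ≤ K i j := fun i j => (norm_nonneg _).trans (hK i j 0)
  set K2 : ℝ := ∑ i, ∑ j, K i j with hK2
  have hbv : ∀ i (v : E), |⟪b i, v⟫| ≤ ‖v‖ := fun i v =>
    (abs_real_inner_le_norm _ _).trans (by rw [b.orthonormal.1 i, one_mul])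
  have hD2le : ∀ y v, |D2 y v v| ≤ K2 * ‖v‖ ^ 2 := by
    intro y v
    rw [hexp (D2 y) v, hK2, Finset.sum_mul]
    refine (Finset.abs_sum_le_sum_abs _ _).trans (Finset.sum_le_sum fun i _ => ?_)
    rw [Finset.sum_mul]
    refine (Finset.abs_sum_le_sum_abs _ _).trans (Finset.sum_le_sum fun j _ => ?_)
    rw [abs_mul, abs_mul]
    have hKy : |D2 y (b i) (b j)| ≤ K i j := by rw [← Real.norm_eq_abs]; exact hK i j y
    calc |⟪b i, v⟫| * |⟪b j, v⟫| * |D2 y (b i) (b j)| ≤ ‖v‖ * ‖v‖ * K i j :=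
          mul_le_mul (mul_le_mul (hbv i v) (hbv j v) (abs_nonneg _) (norm_nonneg _)) hKy
            (abs_nonneg _) (mul_nonneg (norm_nonneg _) (norm_nonneg _))
      _ = K i j * ‖v‖ ^ 2 := by ring
  have hLfun : L = fun x => ∑ i, D2 x (b i) (b i) :=
    funext fun x => Chae2011.laplacian_eq_sum_fderiv_fderiv Ψ x
  have hLc : Continuous L := by
    rw [hLfun]
    exact continuous_finsetSum _ fun i _ => hAc i i
  have hLcs : HasCompactSupport L := by
    refine hD2cs.mono fun x hx => ?_
    rw [mem_support] at hx ⊢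
    intro h0
    apply hx
    rw [hLfun]
    simp [h0]
  obtain ⟨KL, hKL⟩ := hLc.bounded_above_of_compact_support hLcs
  have hK2nn : 0 ≤ K2 :=
    hK2 ▸ Finset.sum_nonneg fun i _ => Finset.sum_nonneg fun j _ => hKnn i j
  have hKLnn : 0 ≤ KL := le_trans (norm_nonneg _) (hKL 0)
  have hLle : ∀ y, |L y| ≤ KL := fun y => by rw [← Real.norm_eq_abs]; exact hKL y
  -- the measure on the slab and the measurability of `u`, `p`
  set μ : Measure (ℝ × E) := (volume : Measure (ℝ × E)).restrict (I ×ˢ (univ : Set E)) with hμ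
  have hμprod : μ = ((volume : Measure ℝ).restrict I).prod (volume : Measure E) := by
    rw [hμ]
    conv_rhs => rw [← Measure.restrict_univ (μ := (volume : Measure E))]
    rw [Measure.prod_restrict, ← Measure.volume_eq_prod]
  have hum : AEStronglyMeasurable (uncurry u) μ := by
    have h := hsol.1.aestronglyMeasurable
    rwa [coe_slab] at h
  have hu2' : Integrable (fun z : ℝ × E => ‖u z.1 z.2‖ ^ 2) μ := hu2
  have hp' : Integrable (fun z : ℝ × E => p z.1 z.2) μ := hp
  -- measurability of `z ↦ D²Ψ(c x)(u, u)` through the coefficient expansion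
  have hmeasD : ∀ c : ℝ, AEStronglyMeasurable
      (fun z : ℝ × E => D2 (c • z.2) (u z.1 z.2) (u z.1 z.2)) μ := fun c => by
    have e : (fun z : ℝ × E => D2 (c • z.2) (u z.1 z.2) (u z.1 z.2)) = fun z =>
        ∑ i, ∑ j, (⟪b i, u z.1 z.2⟫ * ⟪b j, u z.1 z.2⟫) * D2 (c • z.2) (b i) (b j) :=
      funext fun z => hexp _ _
    rw [e]
    refine Finset.aestronglyMeasurable_fun_sum _ fun i _ =>
      Finset.aestronglyMeasurable_fun_sum _ fun j _ => ?_
    have hui : AEStronglyMeasurable (fun z : ℝ × E => ⟪b i, u z.1 z.2⟫) μ :=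
      aestronglyMeasurable_const.inner hum
    have huj : AEStronglyMeasurable (fun z : ℝ × E => ⟪b j, u z.1 z.2⟫) μ :=
      aestronglyMeasurable_const.inner hum
    exact (hui.mul huj).mul (((hAc i j).comp (continuous_snd.const_smul c)).aestronglyMeasurable)
  -- the slice function of the statement
  set h : ℝ × E → ℝ := fun z => D2 0 (u z.1 z.2) (u z.1 z.2) + L 0 * p z.1 z.2 with hh
  have hh1 : Integrable (fun z : ℝ × E => D2 0 (u z.1 z.2) (u z.1 z.2)) μ := by
    refine (hu2'.const_mul K2).mono' (by simpa using hmeasD 0) (Eventually.of_forall fun z => ?_)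
    rw [Real.norm_eq_abs]
    exact hD2le 0 _
  have hh2 : Integrable (fun z : ℝ × E => L 0 * p z.1 z.2) μ := hp'.const_mul _
  have hhint : Integrable h μ := hh1.add hh2
  set g : ℝ → ℝ := fun t => ∫ x, h (t, x) with hg
  have hgint : IntegrableOn g I (volume : Measure ℝ) := by
    have h' : Integrable h (((volume : Measure ℝ).restrict I).prod (volume : Measure E)) := by
      rwa [hμprod] at hhint
    exact h'.integral_prod_left
  -- MAIN STEP: `∫_I ξ g = 0` for every `ξ ∈ C_c^∞(I)`
  have hmain : ∀ ξ : ℝ → ℝ, ContDiff ℝ ∞ ξ → HasCompactSupport ξ → tsupport ξ ⊆ I →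
      ∫ t, ξ t • g t = 0 := by
    intro ξ hξ hξc hξI
    obtain ⟨Cξ, hCξ⟩ := hξ.continuous.bounded_above_of_compact_support hξc
    have hCξnn : 0 ≤ Cξ := le_trans (norm_nonneg _) (hCξ 0)
    have hξle : ∀ t, |ξ t| ≤ Cξ := fun t => by rw [← Real.norm_eq_abs]; exact hCξ t
    -- the scales `R_n = n + 1`, `c_n = 1 / (n + 1) → 0`
    set c : ℕ → ℝ := fun n => 1 / ((n : ℝ) + 1) with hc
    have hc0 : Tendsto c atTop (𝓝 0) := tendsto_one_div_add_atTop_nhds_zero_nat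
    -- the tested identity at scale `R_n`
    set F : ℕ → ℝ × E → ℝ := fun n z =>
      ξ z.1 * D2 (c n • z.2) (u z.1 z.2) (u z.1 z.2) + p z.1 z.2 * (ξ z.1 * L (c n • z.2)) with hF
    have hkey : ∀ n, ∫ z, F n z ∂μ = 0 := by
      intro n
      set R : ℝ := (n : ℝ) + 1 with hR
      have hRpos : 0 < R := by rw [hR]; positivity
      have hRne : R ≠ 0 := hRpos.ne'
      have hcR : c n = R⁻¹ := by simp only [hc, hR, one_div]
      set Φ : E → ℝ := fun y => R ^ 2 • Ψ (R⁻¹ • y) with hΦdef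
      have hΦ' : FunctionSpaces.IsTestFunctionOn (⟨univ, isOpen_univ⟩ : Opens E) Φ :=
        Chae2011.isTestFunctionOn_dilate hΨ hΨc hRne
      have hθ : IsSpaceTimeTestOn (slab E I hI) (fun s x => ξ s • Φ x) :=
        isSpaceTimeTestOn_prod_smul hI isOpen_univ hξ hξc hξI hΦ'
      have hf0 : LocallyIntegrableOn (uncurry (0 : ℝ → E → E))
          ((slab E I hI : Opens (ℝ × E)) : Set (ℝ × E)) volume :=
        integrableOn_zero.locallyIntegrableOn
      have hdiv0 : ∀ φ : ℝ → E → ℝ, IsSpaceTimeTestOn (slab E I hI) φ →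
          ∫ z in ((slab E I hI : Opens (ℝ × E)) : Set (ℝ × E)),
            ⟪(0 : ℝ → E → E) z.1 z.2, gradient (φ z.1) z.2⟫ = 0 := fun φ _ => by simp
      have key := hsol.integral_hessian_add_pressure_laplacian_eq_zero hf0 hdiv0 hθ
      rw [coe_slab] at key
      rw [← key]
      refine integral_congr_ae (Eventually.of_forall fun z => ?_)
      have hsl : (fun x => ξ z.1 • Φ x) = ξ z.1 • Φ := rfl
      simp only [hF]
      rw [hsl, Chae2011.fderiv_fderiv_const_smul, Chae2011.laplacian_const_smul, Pi.smul_apply,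
        hΦdef, Chae2011.fderiv_fderiv_dilate Ψ hRne, Chae2011.laplacian_dilate Ψ hRne, hcR]
      simp only [FunLike.coe_smul, Pi.smul_apply, smul_eq_mul]
      rw [hD2, hL]
    -- dominated convergence as `n → ∞`
    set Flim : ℝ × E → ℝ := fun z =>
      ξ z.1 * D2 0 (u z.1 z.2) (u z.1 z.2) + p z.1 z.2 * (ξ z.1 * L 0) with hFlim
    set bound : ℝ × E → ℝ := fun z =>
      Cξ * (K2 * ‖u z.1 z.2‖ ^ 2) + ‖p z.1 z.2‖ * (Cξ * KL) with hbound
    have hξm : AEStronglyMeasurable (fun z : ℝ × E => ξ z.1) μ :=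
      (hξ.continuous.comp continuous_fst).aestronglyMeasurable
    have hFm : ∀ n, AEStronglyMeasurable (F n) μ := fun n =>
      (hξm.mul (hmeasD (c n))).add (hp'.1.mul
        (hξm.mul ((hLc.comp (continuous_snd.const_smul (c n))).aestronglyMeasurable)))
    have hbint : Integrable bound μ :=
      ((hu2'.const_mul K2).const_mul Cξ).add (hp'.norm.mul_const _)
    have hptwise : ∀ (y : E) (z : ℝ × E),
        ‖ξ z.1 * D2 y (u z.1 z.2) (u z.1 z.2) + p z.1 z.2 * (ξ z.1 * L y)‖ ≤ bound z := by
      intro y z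
      rw [hbound]
      refine (norm_add_le _ _).trans (add_le_add ?_ ?_)
      · rw [norm_mul, Real.norm_eq_abs, Real.norm_eq_abs]
        exact mul_le_mul (hξle _) (hD2le _ _) (abs_nonneg _) hCξnn
      · rw [norm_mul, norm_mul, Real.norm_eq_abs (ξ _), Real.norm_eq_abs (L _)]
        exact mul_le_mul_of_nonneg_left (mul_le_mul (hξle _) (hLle _) (abs_nonneg _) hCξnn)
          (norm_nonneg _)
    have hFle : ∀ n, ∀ᵐ z ∂μ, ‖F n z‖ ≤ bound z := fun n =>
      Eventually.of_forall fun z => hptwise _ z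
    have hFlim_tendsto : ∀ᵐ z ∂μ, Tendsto (fun n => F n z) atTop (𝓝 (Flim z)) := by
      refine Eventually.of_forall fun z => ?_
      have hcz : Tendsto (fun n => c n • z.2) atTop (𝓝 0) := by
        simpa using hc0.smul_const z.2
      have hA : Tendsto (fun n => D2 (c n • z.2) (u z.1 z.2) (u z.1 z.2)) atTop
          (𝓝 (D2 0 (u z.1 z.2) (u z.1 z.2))) := by
        rw [show (fun n => D2 (c n • z.2) (u z.1 z.2) (u z.1 z.2)) = fun n =>
            ∑ i, ∑ j, (⟪b i, u z.1 z.2⟫ * ⟪b j, u z.1 z.2⟫) * D2 (c n • z.2) (b i) (b j) from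
          funext fun n => hexp _ _, hexp (D2 0)]
        exact tendsto_finsetSum _ fun i _ => tendsto_finsetSum _ fun j _ =>
          (((hAc i j).tendsto 0).comp hcz).const_mul _
      have hB : Tendsto (fun n => L (c n • z.2)) atTop (𝓝 (L 0)) := (hLc.tendsto 0).comp hcz
      exact (hA.const_mul _).add ((hB.const_mul _).const_mul _)
    have hDCT := tendsto_integral_of_dominated_convergence bound hFm hbint hFle hFlim_tendsto
    have hzero : Tendsto (fun n => ∫ z, F n z ∂μ) atTop (𝓝 0) := by
      simp_rw [hkey]; exact tendsto_const_nhds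
    have hI0 : ∫ z, Flim z ∂μ = 0 := tendsto_nhds_unique hDCT hzero
    -- Fubini
    have hFlimInt : Integrable Flim μ :=
      hbint.mono' ((hξm.mul (by simpa using hmeasD 0)).add (hp'.1.mul (hξm.mul
        aestronglyMeasurable_const))) (Eventually.of_forall fun z => by
          simpa [hFlim] using hptwise 0 z)
    have hFlimInt' : Integrable Flim (((volume : Measure ℝ).restrict I).prod (volume : Measure E)) := by
      rwa [hμprod] at hFlimInt
    rw [hμprod, integral_prod _ hFlimInt'] at hI0
    have hinner : ∀ t, (∫ x, Flim (t, x)) = ξ t * g t := by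
      intro t
      rw [hg, ← MeasureTheory.integral_const_mul]
      refine integral_congr_ae (Eventually.of_forall fun x => ?_)
      simp only [hFlim, hh]
      ring
    simp_rw [hinner] at hI0
    rw [← setIntegral_eq_integral_of_forall_compl_eq_zero (s := I) fun t ht => by
      rw [image_eq_zero_of_notMem_tsupport fun h' => ht (hξI h'), zero_smul]]
    simpa only [smul_eq_mul] using hI0
  -- du Bois-Reymond in time
  have hae := hI.ae_eq_zero_of_integral_contDiff_smul_eq_zero
    (IntegrableOn.locallyIntegrableOn hgint) hmain
  have hae' : ∀ᵐ t ∂((volume : Measure ℝ).restrict I), g t = 0 :=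
    (ae_restrict_iff' hI.measurableSet).2 hae
  -- split the slice integral
  have hh1' : Integrable (fun z : ℝ × E => D2 0 (u z.1 z.2) (u z.1 z.2))
      (((volume : Measure ℝ).restrict I).prod (volume : Measure E)) := by rwa [hμprod] at hh1
  have hh2' : Integrable (fun z : ℝ × E => L 0 * p z.1 z.2)
      (((volume : Measure ℝ).restrict I).prod (volume : Measure E)) := by rwa [hμprod] at hh2
  filter_upwards [hae', hh1'.prod_right_ae, hh2'.prod_right_ae] with t ht h1 h2
  rw [hg, hh] at ht
  simp only at ht
  rw [integral_add h1 h2, MeasureTheory.integral_const_mul] at ht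
  exact ht

/-- **Chae 2011, Theorem 1.1 (ii) (equipartition of energy), bilinear form.** Under the hypotheses
of `ae_integral_hessian_add_laplacian_mul_integral_pressure_eq_zero`, for all `a b : E` and
almost every `t ∈ I`, `∫ ⟪a, u(t,x)⟫⟪b, u(t,x)⟫ dx = -⟪a, b⟫ ∫ p(t,x) dx`; with `a = b = eⱼ`
this is (111), `ℰⱼ(t) = ½∫(uʲ)² = -½∫p`, and with `a = eⱼ ⊥ b = eₖ` it is (112),
`∫ uʲuᵏ = 0` (the printed proof with `Ψ = x_j x_k σ(x)`). [cite: Chae2011, Thm 1.1 (ii)] -/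
theorem IsDistributionalNSSolutionOn.ae_integral_inner_mul_inner_eq
    (hsol : IsDistributionalNSSolutionOn (slab E I hI) ν 0 u p)
    (hu2 : IntegrableOn (fun z : ℝ × E => ‖u z.1 z.2‖ ^ 2) (I ×ˢ univ) volume)
    (hp : IntegrableOn (uncurry p) (I ×ˢ univ) volume) (a b : E) :
    ∀ᵐ t ∂(volume.restrict I),
      ∫ x, ⟪a, u t x⟫ * ⟪b, u t x⟫ = -(⟪a, b⟫ * ∫ x, p t x) := by
  let σ : ContDiffBump (0 : E) := ⟨1, 2, one_pos, one_lt_two⟩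
  set q : E → ℝ := fun y => ⟪a, y⟫ * ⟪b, y⟫ with hq
  set Ψ : E → ℝ := fun y => σ y * q y with hΨdef
  have hΨ : ContDiff ℝ ∞ Ψ :=
    σ.contDiff.mul ((contDiff_const.inner ℝ contDiff_id).mul (contDiff_const.inner ℝ contDiff_id))
  have hΨc : HasCompactSupport Ψ := σ.hasCompactSupport.mul_right
  have hnhds : Ψ =ᶠ[𝓝 0] q :=
    σ.eventuallyEq_one.mono fun x hx => by rw [hΨdef]; simp only; rw [hx, Pi.one_apply, one_mul]
  have hD : fderiv ℝ (fderiv ℝ Ψ) 0 = fderiv ℝ (fderiv ℝ q) 0 := hnhds.fderiv.fderiv_eq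
  have hLap : Δ Ψ 0 = Δ q 0 := (laplacian_congr_nhds hnhds).eq_of_nhds
  filter_upwards [hsol.ae_integral_hessian_add_laplacian_mul_integral_pressure_eq_zero hu2 hp
    hΨ hΨc] with t ht
  rw [hD, hLap, hq, Chae2011.laplacian_inner_mul_inner] at ht
  simp_rw [Chae2011.fderiv_fderiv_inner_mul_inner] at ht
  rw [MeasureTheory.integral_const_mul] at ht
  linarith

/-- **Chae 2011, Theorem 1.1 (ii), summed over the components**: for almost every `t ∈ I`,
`∫ |u(t,x)|² dx = -N ∫ p(t,x) dx`, `N = dim E` (i.e. `ℰ(t) = Σⱼ ℰⱼ(t) = -(N/2) ∫ p`; the printed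
proof with `Ψ = ½|x|² σ(x)`). [cite: Chae2011, Thm 1.1 (ii)] -/
theorem IsDistributionalNSSolutionOn.ae_integral_norm_sq_eq
    (hsol : IsDistributionalNSSolutionOn (slab E I hI) ν 0 u p)
    (hu2 : IntegrableOn (fun z : ℝ × E => ‖u z.1 z.2‖ ^ 2) (I ×ˢ univ) volume)
    (hp : IntegrableOn (uncurry p) (I ×ˢ univ) volume) :
    ∀ᵐ t ∂(volume.restrict I),
      ∫ x, ‖u t x‖ ^ 2 = -(Module.finrank ℝ E * ∫ x, p t x) := by
  let σ : ContDiffBump (0 : E) := ⟨1, 2, one_pos, one_lt_two⟩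
  set q : E → ℝ := fun y => ‖y‖ ^ 2 with hq
  set Ψ : E → ℝ := fun y => σ y * q y with hΨdef
  have hΨ : ContDiff ℝ ∞ Ψ := σ.contDiff.mul (contDiff_norm_sq ℝ)
  have hΨc : HasCompactSupport Ψ := σ.hasCompactSupport.mul_right
  have hnhds : Ψ =ᶠ[𝓝 0] q :=
    σ.eventuallyEq_one.mono fun x hx => by rw [hΨdef]; simp only; rw [hx, Pi.one_apply, one_mul]
  have hD : fderiv ℝ (fderiv ℝ Ψ) 0 = fderiv ℝ (fderiv ℝ q) 0 := hnhds.fderiv.fderiv_eq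
  have hLap : Δ Ψ 0 = Δ q 0 := (laplacian_congr_nhds hnhds).eq_of_nhds
  filter_upwards [hsol.ae_integral_hessian_add_laplacian_mul_integral_pressure_eq_zero hu2 hp
    hΨ hΨc] with t ht
  rw [hD, hLap, hq, Chae2011.laplacian_norm_sq] at ht
  simp_rw [Chae2011.fderiv_fderiv_norm_sq] at ht
  rw [MeasureTheory.integral_const_mul] at ht
  linarith

/-- **Chae 2011, Theorem 1.1 (i) (Liouville type property).** Let `(u, p)` be a distributional
solution of the Navier–Stokes or Euler equations on the slab `I × E` with `|u|², p` integrable on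
`I × E`, and suppose `∫ p(t,x) dx ≥ 0` for almost every `t ∈ I`. Then `u = 0` almost everywhere
on `I × E` (from `∫|u(t)|² = -N∫p(t) ≤ 0` for a.e. `t`). [cite: Chae2011, Thm 1.1 (i)] -/
theorem IsDistributionalNSSolutionOn.ae_eq_zero_of_integral_pressure_nonneg
    (hsol : IsDistributionalNSSolutionOn (slab E I hI) ν 0 u p)
    (hu2 : IntegrableOn (fun z : ℝ × E => ‖u z.1 z.2‖ ^ 2) (I ×ˢ univ) volume)
    (hp : IntegrableOn (uncurry p) (I ×ˢ univ) volume)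
    (hpos : ∀ᵐ t ∂(volume.restrict I), 0 ≤ ∫ x, p t x) :
    ∀ᵐ z ∂(volume.restrict (I ×ˢ (univ : Set E))), u z.1 z.2 = 0 := by
  set μ : Measure (ℝ × E) := (volume : Measure (ℝ × E)).restrict (I ×ˢ (univ : Set E)) with hμ
  have hμprod : μ = ((volume : Measure ℝ).restrict I).prod (volume : Measure E) := by
    rw [hμ]
    conv_rhs => rw [← Measure.restrict_univ (μ := (volume : Measure E))]
    rw [Measure.prod_restrict, ← Measure.volume_eq_prod]
  have hu2' : Integrable (fun z : ℝ × E => ‖u z.1 z.2‖ ^ 2) μ := hu2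
  have hu2'' : Integrable (fun z : ℝ × E => ‖u z.1 z.2‖ ^ 2)
      (((volume : Measure ℝ).restrict I).prod (volume : Measure E)) := by rwa [hμprod] at hu2'
  -- `∫∫ |u|² = ∫ (∫ |u(t)|² dx) dt ≤ 0`
  have hslice : ∀ᵐ t ∂((volume : Measure ℝ).restrict I), (∫ x, ‖u t x‖ ^ 2) ≤ 0 := by
    filter_upwards [hsol.ae_integral_norm_sq_eq hu2 hp, hpos] with t ht h0
    rw [ht, neg_nonpos]
    positivity
  have hle : ∫ z, ‖u z.1 z.2‖ ^ 2 ∂μ ≤ 0 := by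
    rw [hμprod, integral_prod _ hu2'']
    exact integral_nonpos_of_ae hslice
  have hge : 0 ≤ ∫ z, ‖u z.1 z.2‖ ^ 2 ∂μ := integral_nonneg fun z => by positivity
  have h0 : ∫ z, ‖u z.1 z.2‖ ^ 2 ∂μ = 0 := le_antisymm hle hge
  have hae := (integral_eq_zero_iff_of_nonneg (fun z => by positivity) hu2').1 h0
  filter_upwards [hae] with z hz
  simpa using hz

/-! ### The printed instances: the slab `(0, T) × E` -/

/-- **Chae 2011, Theorem 1.1 (i)** on `ℝ^N × (0, T)` as printed: a distributional solution of
`(NS)_ν` (any `ν`; Euler for `ν = 0`) on `(0, T) × E` with `|v|², p ∈ L¹((0,T) × E)` and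
`∫ p(x,t) dx ≥ 0` for a.e. `t ∈ (0, T)` vanishes a.e. [cite: Chae2011, Thm 1.1 (i)] -/
theorem chae2011_thm11_i {T : ℝ} {v : ℝ → E → E} {p : ℝ → E → ℝ}
    (hsol : IsDistributionalNSSolutionOn (slab E (Ioo 0 T) isOpen_Ioo) ν 0 v p)
    (hv2 : IntegrableOn (fun z : ℝ × E => ‖v z.1 z.2‖ ^ 2) (Ioo 0 T ×ˢ univ) volume)
    (hp : IntegrableOn (uncurry p) (Ioo 0 T ×ˢ univ) volume)
    (hpos : ∀ᵐ t ∂(volume.restrict (Ioo 0 T)), 0 ≤ ∫ x, p t x) :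
    ∀ᵐ z ∂(volume.restrict (Ioo 0 T ×ˢ (univ : Set E))), v z.1 z.2 = 0 :=
  hsol.ae_eq_zero_of_integral_pressure_nonneg hv2 hp hpos

/-- **Chae 2011, Theorem 1.1 (ii)** on `ℝ^N × (0, T)` as printed (bilinear form): for a
distributional solution of `(NS)_ν` on `(0, T) × E` with `|v|², p ∈ L¹((0,T) × E)`, for all
`a b : E` and a.e. `t ∈ (0, T)`, `∫ ⟪a, v⟫⟪b, v⟫ dx = -⟪a, b⟫ ∫ p dx` — equipartition
`ℰⱼ(t) = -½∫p(t)` and orthogonality `∫ vʲvᵏ = 0`, `j ≠ k`. [cite: Chae2011, Thm 1.1 (ii)] -/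
theorem chae2011_thm11_ii {T : ℝ} {v : ℝ → E → E} {p : ℝ → E → ℝ}
    (hsol : IsDistributionalNSSolutionOn (slab E (Ioo 0 T) isOpen_Ioo) ν 0 v p)
    (hv2 : IntegrableOn (fun z : ℝ × E => ‖v z.1 z.2‖ ^ 2) (Ioo 0 T ×ˢ univ) volume)
    (hp : IntegrableOn (uncurry p) (Ioo 0 T ×ˢ univ) volume) (a b : E) :
    ∀ᵐ t ∂(volume.restrict (Ioo 0 T)),
      ∫ x, ⟪a, v t x⟫ * ⟪b, v t x⟫ = -(⟪a, b⟫ * ∫ x, p t x) :=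
  hsol.ae_integral_inner_mul_inner_eq hv2 hp a b

end Main

/-! ### Weighted form of the master identity: smooth weights of controlled growth
(Chae, *Liouville type of theorems with weights for the Navier–Stokes and the Euler equations*,
arXiv:0811.4647 (2008), Thm 1.1, proof §2: the test fields `∇(W(|x|) σ(|x|/R))`) -/

namespace Chae2011

section WeightedCalculus

variable {F : Type*} [NormedAddCommGroup F] [NormedSpace ℝ F]

omit [MeasurableSpace E] [BorelSpace E] in
/-- Expansion of the quadratic form of `B : E →L E →L ℝ` in the standard orthonormal frame. [folklore] -/
private theorem apply_apply_eq_sum (B : E →L[ℝ] E →L[ℝ] ℝ) (v : E) :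
    B v v = ∑ i, ∑ j, (⟪stdOrthonormalBasis ℝ E i, v⟫ * ⟪stdOrthonormalBasis ℝ E j, v⟫) *
      B (stdOrthonormalBasis ℝ E i) (stdOrthonormalBasis ℝ E j) := by
  set b := stdOrthonormalBasis ℝ E
  conv_lhs => rw [← b.sum_repr' v]
  simp only [map_sum, map_smul, FunLike.coe_sum, Finset.sum_apply, FunLike.coe_smul,
    Pi.smul_apply, smul_eq_mul, Finset.mul_sum]
  rw [Finset.sum_comm]
  refine Finset.sum_congr rfl fun i _ => Finset.sum_congr rfl fun j _ => ?_
  ring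

omit [MeasurableSpace E] [BorelSpace E] in
/-- Expansion of a linear functional in the standard orthonormal frame. [folklore] -/
private theorem apply_eq_sum (ℓ : E →L[ℝ] ℝ) (v : E) :
    ℓ v = ∑ i, ⟪stdOrthonormalBasis ℝ E i, v⟫ * ℓ (stdOrthonormalBasis ℝ E i) := by
  set b := stdOrthonormalBasis ℝ E
  conv_lhs => rw [← b.sum_repr' v]
  simp only [map_sum, map_smul, smul_eq_mul]

omit [MeasurableSpace E] [BorelSpace E] in
/-- A uniform bound `|DΨ(y)(v)| ≤ K ‖v‖` for a smooth compactly supported `Ψ`, obtained through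
the (scalar, compactly supported, continuous) frame coefficients `y ↦ DΨ(y)(eᵢ)`. [folklore] -/
private theorem exists_bound_fderiv_apply {Ψ : E → ℝ} (hΨ : ContDiff ℝ ∞ Ψ)
    (hΨc : HasCompactSupport Ψ) :
    ∃ K : ℝ, 0 ≤ K ∧ ∀ y v, |fderiv ℝ Ψ y v| ≤ K * ‖v‖ := by
  set b := stdOrthonormalBasis ℝ E with hb
  have hΨ2 : ContDiff ℝ 2 Ψ := contDiff_infty.1 hΨ 2
  have hD1c := hΨ2.continuous_fderiv (by simp)
  have hD1cs : HasCompactSupport (fderiv ℝ Ψ) := hΨc.fderiv (𝕜 := ℝ)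
  have hAc : ∀ i, Continuous fun y => fderiv ℝ Ψ y (b i) := fun i =>
    hD1c.clm_apply continuous_const
  have hAcs : ∀ i, HasCompactSupport fun y => fderiv ℝ Ψ y (b i) := fun i =>
    hD1cs.mono fun y hy => by
      rw [mem_support] at hy ⊢
      intro h0
      apply hy
      simp [h0]
  choose K hK using fun i => (hAc i).bounded_above_of_compact_support (hAcs i)
  have hKnn : ∀ i, 0 ≤ K i := fun i => (norm_nonneg _).trans (hK i 0)
  have hbv : ∀ i (v : E), |⟪b i, v⟫| ≤ ‖v‖ := fun i v =>
    (abs_real_inner_le_norm _ _).trans (by rw [b.orthonormal.1 i, one_mul])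
  refine ⟨∑ i, K i, Finset.sum_nonneg fun i _ => hKnn i, fun y v => ?_⟩
  rw [apply_eq_sum (fderiv ℝ Ψ y) v, Finset.sum_mul]
  refine (Finset.abs_sum_le_sum_abs _ _).trans (Finset.sum_le_sum fun i _ => ?_)
  rw [abs_mul]
  have hKy : |fderiv ℝ Ψ y (b i)| ≤ K i := by rw [← Real.norm_eq_abs]; exact hK i y
  calc |⟪b i, v⟫| * |fderiv ℝ Ψ y (b i)| ≤ ‖v‖ * K i :=
        mul_le_mul (hbv i v) hKy (abs_nonneg _) (norm_nonneg _)
    _ = K i * ‖v‖ := mul_comm _ _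

omit [MeasurableSpace E] [BorelSpace E] in
/-- A uniform bound `|D²Ψ(y)(v, v)| ≤ K ‖v‖²` for a smooth compactly supported `Ψ`, obtained
through the (scalar, compactly supported, continuous) frame coefficients `y ↦ D²Ψ(y)(eᵢ, eⱼ)`. [folklore] -/
private theorem exists_bound_fderiv_fderiv_apply {Ψ : E → ℝ} (hΨ : ContDiff ℝ ∞ Ψ)
    (hΨc : HasCompactSupport Ψ) :
    ∃ K : ℝ, 0 ≤ K ∧ ∀ y v, |fderiv ℝ (fderiv ℝ Ψ) y v v| ≤ K * ‖v‖ ^ 2 := by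
  set b := stdOrthonormalBasis ℝ E with hb
  set D2 : E → E →L[ℝ] E →L[ℝ] ℝ := fderiv ℝ (fderiv ℝ Ψ) with hD2
  have hΨ3 : ContDiff ℝ 3 Ψ := contDiff_infty.1 hΨ 3
  have hD1 : ContDiff ℝ 2 (fderiv ℝ Ψ) := hΨ3.fderiv_right (m := 2) le_rfl
  have hD2c := hD1.continuous_fderiv (by simp)
  have hD2cs : HasCompactSupport D2 := (hΨc.fderiv (𝕜 := ℝ)).fderiv (𝕜 := ℝ)
  have hAc : ∀ i j, Continuous fun y => D2 y (b i) (b j) := fun i j =>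
    (hD2c.clm_apply continuous_const).clm_apply continuous_const
  have hAcs : ∀ i j, HasCompactSupport fun y => D2 y (b i) (b j) := fun i j =>
    hD2cs.mono fun y hy => by
      rw [mem_support] at hy ⊢
      intro h0
      apply hy
      simp [h0]
  choose K hK using fun i j => (hAc i j).bounded_above_of_compact_support (hAcs i j)
  have hKnn : ∀ i j, 0 ≤ K i j := fun i j => (norm_nonneg _).trans (hK i j 0)
  have hbv : ∀ i (v : E), |⟪b i, v⟫| ≤ ‖v‖ := fun i v =>
    (abs_real_inner_le_norm _ _).trans (by rw [b.orthonormal.1 i, one_mul])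
  refine ⟨∑ i, ∑ j, K i j, Finset.sum_nonneg fun i _ => Finset.sum_nonneg fun j _ => hKnn i j,
    fun y v => ?_⟩
  rw [apply_apply_eq_sum (D2 y) v, Finset.sum_mul]
  refine (Finset.abs_sum_le_sum_abs _ _).trans (Finset.sum_le_sum fun i _ => ?_)
  rw [Finset.sum_mul]
  refine (Finset.abs_sum_le_sum_abs _ _).trans (Finset.sum_le_sum fun j _ => ?_)
  rw [abs_mul, abs_mul]
  have hKy : |D2 y (b i) (b j)| ≤ K i j := by rw [← Real.norm_eq_abs]; exact hK i j y
  calc |⟪b i, v⟫| * |⟪b j, v⟫| * |D2 y (b i) (b j)| ≤ ‖v‖ * ‖v‖ * K i j :=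
        mul_le_mul (mul_le_mul (hbv i v) (hbv j v) (abs_nonneg _) (norm_nonneg _)) hKy
          (abs_nonneg _) (mul_nonneg (norm_nonneg _) (norm_nonneg _))
    _ = K i j * ‖v‖ ^ 2 := by ring

omit [FiniteDimensional ℝ E] [MeasurableSpace E] [BorelSpace E] in
/-- **Hessian of a product**: `D²(sΦ)(x)(v, v) = s D²Φ(v, v) + 2 Ds(v) DΦ(v) + Φ D²s(v, v)` for
`C²` functions. [folklore] -/
private theorem fderiv_fderiv_mul_apply {s Φ : E → ℝ} (hs : ContDiff ℝ 2 s) (hΦ : ContDiff ℝ 2 Φ)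
    (x v : E) :
    fderiv ℝ (fderiv ℝ (fun y => s y * Φ y)) x v v =
      s x * fderiv ℝ (fderiv ℝ Φ) x v v + 2 * (fderiv ℝ s x v * fderiv ℝ Φ x v) +
        Φ x * fderiv ℝ (fderiv ℝ s) x v v := by
  have hs1 : Differentiable ℝ s := hs.differentiable (by norm_num)
  have hΦ1 : Differentiable ℝ Φ := hΦ.differentiable (by norm_num)
  have hs2 : Differentiable ℝ (fderiv ℝ s) :=
    (hs.fderiv_right (m := 1) (by norm_num)).differentiable one_ne_zero
  have hΦ2 : Differentiable ℝ (fderiv ℝ Φ) :=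
    (hΦ.fderiv_right (m := 1) (by norm_num)).differentiable one_ne_zero
  have h1 : fderiv ℝ (fun y => s y * Φ y) = fun y => s y • fderiv ℝ Φ y + Φ y • fderiv ℝ s y :=
    funext fun y => fderiv_fun_mul (hs1 y) (hΦ1 y)
  have h2 : HasFDerivAt (fun y => s y • fderiv ℝ Φ y + Φ y • fderiv ℝ s y)
      ((s x • fderiv ℝ (fderiv ℝ Φ) x + (fderiv ℝ s x).smulRight (fderiv ℝ Φ x)) +
        (Φ x • fderiv ℝ (fderiv ℝ s) x + (fderiv ℝ Φ x).smulRight (fderiv ℝ s x))) x :=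
    ((hs1 x).hasFDerivAt.fun_smul (hΦ2 x).hasFDerivAt).fun_add
      ((hΦ1 x).hasFDerivAt.fun_smul (hs2 x).hasFDerivAt)
  rw [h1, h2.fderiv]
  simp only [add_apply, smul_apply, ContinuousLinearMap.smulRight_apply, smul_eq_mul]
  ring

omit [MeasurableSpace E] [BorelSpace E] in
/-- **Laplacian of a product**: `Δ(sΦ) = s ΔΦ + 2 Σᵢ ∂ᵢs ∂ᵢΦ + Φ Δs`. [folklore] -/
private theorem laplacian_mul {s Φ : E → ℝ} (hs : ContDiff ℝ 2 s) (hΦ : ContDiff ℝ 2 Φ) (x : E) :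
    Δ (fun y => s y * Φ y) x = s x * Δ Φ x +
      2 * ∑ i, fderiv ℝ s x (stdOrthonormalBasis ℝ E i) * fderiv ℝ Φ x (stdOrthonormalBasis ℝ E i) +
        Φ x * Δ s x := by
  rw [laplacian_eq_sum_fderiv_fderiv, laplacian_eq_sum_fderiv_fderiv Φ,
    laplacian_eq_sum_fderiv_fderiv s]
  simp only [fderiv_fderiv_mul_apply hs hΦ, Finset.sum_add_distrib, Finset.mul_sum]

omit [FiniteDimensional ℝ E] [MeasurableSpace E] [BorelSpace E] in
/-- `D(f(c ·))(x) = c • Df(c x)` (no differentiability hypothesis). [folklore] -/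
private theorem fderiv_comp_smul_apply (f : E → F) (c : ℝ) (x : E) :
    fderiv ℝ (fun y => f (c • y)) x = c • fderiv ℝ f (c • x) := by
  have h := fderiv_const_smul_comp_smul_apply f 1 c x
  simpa only [one_smul, one_mul] using h

omit [FiniteDimensional ℝ E] [MeasurableSpace E] [BorelSpace E] in
/-- `D²(f(c ·)) = z ↦ c² • D²f(c z)`. [folklore] -/
private theorem fderiv_fderiv_comp_smul (f : E → F) (c : ℝ) :
    fderiv ℝ (fderiv ℝ fun y => f (c • y)) = fun z => c ^ 2 • fderiv ℝ (fderiv ℝ f) (c • z) := by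
  have h1 : (fderiv ℝ fun y => f (c • y)) = fun z => c • fderiv ℝ f (c • z) :=
    funext (fderiv_comp_smul_apply f c)
  rw [h1]
  funext z
  rw [fderiv_const_smul_comp_smul_apply (fderiv ℝ f) c c z, sq]

omit [MeasurableSpace E] [BorelSpace E] in
/-- `Δ(f(c ·))(x) = c² • (Δf)(c x)`. [folklore] -/
private theorem laplacian_comp_smul (f : E → F) (c : ℝ) (x : E) :
    Δ (fun y => f (c • y)) x = c ^ 2 • Δ f (c • x) := by
  rw [laplacian_eq_sum_fderiv_fderiv, laplacian_eq_sum_fderiv_fderiv, fderiv_fderiv_comp_smul,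
    Finset.smul_sum]
  rfl

end WeightedCalculus

end Chae2011

section Weighted

variable {I : Set ℝ} {hI : IsOpen I} {ν : ℝ} {u : ℝ → E → E} {p : ℝ → E → ℝ}

/-- **The weighted identity** (Chae, arXiv:0811.4647, proof of Thm 1.1: the test fields
`∇(W(|x|)σ(|x|/R))`, `R → ∞`; here for an arbitrary smooth weight). Let `(u, p)` be a
distributional solution of the Navier–Stokes or Euler equations on the slab `I × E` and let
`Φ ∈ C^∞(E)` be a weight with `|D²Φ(x)(v,v)| ≤ w(x)|v|²` such that, on `I × E`,
`|u|² w`, `|p| w`, `|u|² |∇Φ|/(1+|x|)`, `|p| |∇Φ|/(1+|x|)`, `|u|² |Φ|/(1+|x|)²`,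
`|p| |Φ|/(1+|x|)²` are integrable. Then for almost every `t ∈ I`,
`∫ D²Φ(x)(u(t,x), u(t,x)) dx + ∫ p(t,x) ΔΦ(x) dx = 0`.
Proof as printed: test with `∇(ξ(t) σ(x/R) Φ(x))` (the `∂ₜ` and `νΔ` terms vanish on gradients),
expand `D²(σ_R Φ) = σ_R D²Φ + 2∇σ_R ⊗ ∇Φ + Φ D²σ_R`, and let `R → ∞` by dominated convergence
(`|∇σ_R| ≲ R⁻¹ 𝟙_{R ≤ |x| ≤ 2R} ≲ (1+|x|)⁻¹`, `|D²σ_R| ≲ (1+|x|)⁻²` on the shell). With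
`Φ = ½|x|²` this is Chae 2011 Thm 1.1; with `Φ = W(|x|)`, `W'' = w`, it is the identity of
arXiv:0811.4647 Thm 1.1. [cite: Chae2008Weighted, Thm 1.1 (proof, §2)] [cite: Chae2011, Thm 1.1 (proof, §2 (21)–(24))] -/
theorem IsDistributionalNSSolutionOn.ae_integral_hessian_apply_add_integral_pressure_mul_laplacian_eq_zero
    (hsol : IsDistributionalNSSolutionOn (slab E I hI) ν 0 u p)
    {Φ : E → ℝ} (hΦ : ContDiff ℝ ∞ Φ) {w : E → ℝ}
    (hw : ∀ x v, |fderiv ℝ (fderiv ℝ Φ) x v v| ≤ w x * ‖v‖ ^ 2)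
    (hI1 : IntegrableOn (fun z : ℝ × E => ‖u z.1 z.2‖ ^ 2 * w z.2) (I ×ˢ univ) volume)
    (hI2 : IntegrableOn (fun z : ℝ × E => |p z.1 z.2| * w z.2) (I ×ˢ univ) volume)
    (hI3 : IntegrableOn (fun z : ℝ × E => ‖u z.1 z.2‖ ^ 2 * (‖fderiv ℝ Φ z.2‖ / (1 + ‖z.2‖)))
      (I ×ˢ univ) volume)
    (hI4 : IntegrableOn (fun z : ℝ × E => |p z.1 z.2| * (‖fderiv ℝ Φ z.2‖ / (1 + ‖z.2‖)))
      (I ×ˢ univ) volume)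
    (hI5 : IntegrableOn (fun z : ℝ × E => ‖u z.1 z.2‖ ^ 2 * (|Φ z.2| / (1 + ‖z.2‖) ^ 2))
      (I ×ˢ univ) volume)
    (hI6 : IntegrableOn (fun z : ℝ × E => |p z.1 z.2| * (|Φ z.2| / (1 + ‖z.2‖) ^ 2))
      (I ×ˢ univ) volume) :
    ∀ᵐ t ∂(volume.restrict I),
      (∫ x, fderiv ℝ (fderiv ℝ Φ) x (u t x) (u t x)) + ∫ x, p t x * Δ Φ x = 0 := by
  set b := stdOrthonormalBasis ℝ E with hb
  set D2 : E → E →L[ℝ] E →L[ℝ] ℝ := fderiv ℝ (fderiv ℝ Φ) with hD2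
  set N : ℝ := (Module.finrank ℝ E : ℝ) with hN
  set D1 : E → E →L[ℝ] ℝ := fderiv ℝ Φ with hD1
  set L : E → ℝ := Δ Φ with hL
  -- regularity of `Φ`
  have hΦ2 : ContDiff ℝ 2 Φ := contDiff_infty.1 hΦ 2
  have hΦ3 : ContDiff ℝ 3 Φ := contDiff_infty.1 hΦ 3
  have hΦc : Continuous Φ := hΦ.continuous
  have hD1c := hΦ2.continuous_fderiv (by simp)
  have hD2c := (hΦ3.fderiv_right (m := 2) le_rfl).continuous_fderiv (by simp)
  have hAc : ∀ i j, Continuous fun y => D2 y (b i) (b j) := fun i j =>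
    (hD2c.clm_apply continuous_const).clm_apply continuous_const
  have hA1c : ∀ i, Continuous fun y => D1 y (b i) := fun i => hD1c.clm_apply continuous_const
  have hLfun : L = fun x => ∑ i, D2 x (b i) (b i) :=
    funext fun x => Chae2011.laplacian_eq_sum_fderiv_fderiv Φ x
  have hLc : Continuous L := by
    rw [hLfun]
    exact continuous_finsetSum _ fun i _ => hAc i i
  have hLle : ∀ x, |L x| ≤ N * w x := fun x => by
    rw [hLfun]
    refine (Finset.abs_sum_le_sum_abs _ _).trans ?_
    calc ∑ i, |D2 x (b i) (b i)| ≤ ∑ _i : Fin (Module.finrank ℝ E), w x :=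
          Finset.sum_le_sum fun i _ => by
            have h := hw x (b i)
            rwa [b.orthonormal.1 i, one_pow, mul_one] at h
      _ = N * w x := by
          simp only [Finset.sum_const, Finset.card_univ, Fintype.card_fin, nsmul_eq_mul, hN]
  -- the cut-off and its bounds
  let σ : ContDiffBump (0 : E) := ⟨1, 2, one_pos, one_lt_two⟩
  have hσ : ContDiff ℝ ∞ σ := σ.contDiff
  have hσ2 : ContDiff ℝ 2 σ := contDiff_infty.1 hσ 2
  have hσc : HasCompactSupport σ := σ.hasCompactSupport
  have hσle : ∀ y, |σ y| ≤ 1 := fun y => by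
    rw [abs_of_nonneg (σ.nonneg' y)]
    exact σ.le_one
  have hDσc := hσ2.continuous_fderiv (by simp)
  obtain ⟨K₁, hK₁nn, hK₁⟩ := Chae2011.exists_bound_fderiv_apply hσ hσc
  obtain ⟨K₂, hK₂nn, hK₂⟩ := Chae2011.exists_bound_fderiv_fderiv_apply hσ hσc
  have hDσ1c : ∀ i, Continuous fun y => fderiv ℝ σ y (b i) := fun i =>
    hDσc.clm_apply continuous_const
  have hσ3 : ContDiff ℝ 3 σ := contDiff_infty.1 hσ 3
  have hD2σc := (hσ3.fderiv_right (m := 2) le_rfl).continuous_fderiv (by simp)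
  have hAσc : ∀ i j, Continuous fun y => fderiv ℝ (fderiv ℝ σ) y (b i) (b j) := fun i j =>
    (hD2σc.clm_apply continuous_const).clm_apply continuous_const
  have hΔσfun : Δ (σ : E → ℝ) = fun x => ∑ i, fderiv ℝ (fderiv ℝ σ) x (b i) (b i) :=
    funext fun x => Chae2011.laplacian_eq_sum_fderiv_fderiv σ x
  have hΔσc : Continuous (Δ (σ : E → ℝ)) := by
    rw [hΔσfun]
    exact continuous_finsetSum _ fun i _ => hAσc i i
  have hΔσle : ∀ y, |Δ (σ : E → ℝ) y| ≤ N * K₂ := fun y => by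
    rw [hΔσfun]
    refine (Finset.abs_sum_le_sum_abs _ _).trans ?_
    calc ∑ i, |fderiv ℝ (fderiv ℝ σ) y (b i) (b i)| ≤ ∑ _i : Fin (Module.finrank ℝ E), K₂ :=
          Finset.sum_le_sum fun i _ => by
            have h := hK₂ y (b i)
            rwa [b.orthonormal.1 i, one_pow, mul_one] at h
      _ = N * K₂ := by
          simp only [Finset.sum_const, Finset.card_univ, Fintype.card_fin, nsmul_eq_mul, hN]
  -- where the derivatives of the cut-off vanish: off the shell `1 ≤ ‖y‖ ≤ 2`
  have hDσ_zero_in : ∀ y : E, ‖y‖ < 1 → fderiv ℝ σ y = 0 := fun y hy => by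
    have h1 : (σ : E → ℝ) =ᶠ[𝓝 y] fun _ => (1 : ℝ) :=
      σ.eventuallyEq_one_of_mem_ball (by simpa using hy)
    rw [h1.fderiv_eq, fderiv_const_apply]
  have hDσ_zero_out : ∀ y : E, 2 < ‖y‖ → fderiv ℝ σ y = 0 := fun y hy => by
    apply fderiv_of_notMem_tsupport
    rw [σ.tsupport_eq]
    simpa using hy
  have hD2σ_zero_in : ∀ y : E, ‖y‖ < 1 → fderiv ℝ (fderiv ℝ σ) y = 0 := fun y hy => by
    have h1 : fderiv ℝ (σ : E → ℝ) =ᶠ[𝓝 y] fun _ => (0 : E →L[ℝ] ℝ) := by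
      filter_upwards [isOpen_lt continuous_norm continuous_const |>.mem_nhds hy] with z hz
      exact hDσ_zero_in z hz
    rw [h1.fderiv_eq, fderiv_const_apply]
  have hD2σ_zero_out : ∀ y : E, 2 < ‖y‖ → fderiv ℝ (fderiv ℝ σ) y = 0 := fun y hy => by
    apply fderiv_of_notMem_tsupport
    intro hmem
    have h2 := tsupport_fderiv_subset ℝ hmem
    rw [σ.tsupport_eq] at h2
    have : ‖y‖ ≤ 2 := by simpa using h2
    linarith
  -- the shell estimate: if `0 < c ≤ 1` and `D σ(c x) ≠ 0` (first or second derivative) then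
  -- `c ≤ 4 / (1 + ‖x‖)`
  have hshell : ∀ (c : ℝ) (x : E), 0 < c → c ≤ 1 → 1 ≤ ‖c • x‖ → ‖c • x‖ ≤ 2 →
      c ≤ 4 / (1 + ‖x‖) := by
    intro c x hc hc1 h1 h2
    rw [norm_smul, Real.norm_eq_abs, abs_of_pos hc] at h1 h2
    have hx1 : 1 ≤ ‖x‖ := by nlinarith
    rw [le_div_iff₀ (by positivity)]
    nlinarith
  -- the measure on the slab and the measurability of `u`, `p`
  set μ : Measure (ℝ × E) := (volume : Measure (ℝ × E)).restrict (I ×ˢ (univ : Set E)) with hμ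
  have hμprod : μ = ((volume : Measure ℝ).restrict I).prod (volume : Measure E) := by
    rw [hμ]
    conv_rhs => rw [← Measure.restrict_univ (μ := (volume : Measure E))]
    rw [Measure.prod_restrict, ← Measure.volume_eq_prod]
  have hum : AEStronglyMeasurable (uncurry u) μ := by
    have h := hsol.1.aestronglyMeasurable
    rwa [coe_slab] at h
  have hpm : AEStronglyMeasurable (uncurry p) μ := by
    have h := hsol.2.2.1.aestronglyMeasurable
    rwa [coe_slab] at h
  have hpm' : AEStronglyMeasurable (fun z : ℝ × E => p z.1 z.2) μ := hpm
  have hI1' : Integrable (fun z : ℝ × E => ‖u z.1 z.2‖ ^ 2 * w z.2) μ := hI1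
  have hI2' : Integrable (fun z : ℝ × E => |p z.1 z.2| * w z.2) μ := hI2
  have hI3' : Integrable (fun z : ℝ × E => ‖u z.1 z.2‖ ^ 2 * (‖D1 z.2‖ / (1 + ‖z.2‖))) μ := hI3
  have hI4' : Integrable (fun z : ℝ × E => |p z.1 z.2| * (‖D1 z.2‖ / (1 + ‖z.2‖))) μ := hI4
  have hI5' : Integrable (fun z : ℝ × E => ‖u z.1 z.2‖ ^ 2 * (|Φ z.2| / (1 + ‖z.2‖) ^ 2)) μ :=
    hI5
  have hI6' : Integrable (fun z : ℝ × E => |p z.1 z.2| * (|Φ z.2| / (1 + ‖z.2‖) ^ 2)) μ := hI6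
  -- measurability of the quadratic / linear forms in `u` with continuous coefficients
  have hui : ∀ i, AEStronglyMeasurable (fun z : ℝ × E => ⟪b i, u z.1 z.2⟫) μ := fun i =>
    aestronglyMeasurable_const.inner hum
  have hmeasQ : ∀ {G : E → E →L[ℝ] E →L[ℝ] ℝ}, (∀ i j, Continuous fun y => G y (b i) (b j)) →
      ∀ c : ℝ, AEStronglyMeasurable (fun z : ℝ × E => G (c • z.2) (u z.1 z.2) (u z.1 z.2)) μ := by
    intro G hG c
    have e : (fun z : ℝ × E => G (c • z.2) (u z.1 z.2) (u z.1 z.2)) = fun z =>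
        ∑ i, ∑ j, (⟪b i, u z.1 z.2⟫ * ⟪b j, u z.1 z.2⟫) * G (c • z.2) (b i) (b j) :=
      funext fun z => Chae2011.apply_apply_eq_sum _ _
    rw [e]
    refine Finset.aestronglyMeasurable_fun_sum _ fun i _ =>
      Finset.aestronglyMeasurable_fun_sum _ fun j _ => ?_
    exact ((hui i).mul (hui j)).mul (((hG i j).comp (continuous_snd.const_smul c)).aestronglyMeasurable)
  have hmeasLin : ∀ {G : E → E →L[ℝ] ℝ}, (∀ i, Continuous fun y => G y (b i)) →
      ∀ c : ℝ, AEStronglyMeasurable (fun z : ℝ × E => G (c • z.2) (u z.1 z.2)) μ := by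
    intro G hG c
    have e : (fun z : ℝ × E => G (c • z.2) (u z.1 z.2)) = fun z =>
        ∑ i, ⟪b i, u z.1 z.2⟫ * G (c • z.2) (b i) :=
      funext fun z => Chae2011.apply_eq_sum _ _
    rw [e]
    refine Finset.aestronglyMeasurable_fun_sum _ fun i _ => ?_
    exact (hui i).mul (((hG i).comp (continuous_snd.const_smul c)).aestronglyMeasurable)
  -- the slice function of the statement
  set h : ℝ × E → ℝ := fun z => D2 z.2 (u z.1 z.2) (u z.1 z.2) + p z.1 z.2 * L z.2 with hh
  have hh1 : Integrable (fun z : ℝ × E => D2 z.2 (u z.1 z.2) (u z.1 z.2)) μ := by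
    refine hI1'.mono' (by simpa using hmeasQ hAc 1) (Eventually.of_forall fun z => ?_)
    rw [Real.norm_eq_abs, mul_comm]
    exact hw _ _
  have hh2 : Integrable (fun z : ℝ × E => p z.1 z.2 * L z.2) μ := by
    refine (hI2'.const_mul N).mono' (hpm'.mul ((hLc.comp continuous_snd).aestronglyMeasurable))
      (Eventually.of_forall fun z => ?_)
    rw [norm_mul, Real.norm_eq_abs, Real.norm_eq_abs]
    calc |p z.1 z.2| * |L z.2| ≤ |p z.1 z.2| * (N * w z.2) :=
          mul_le_mul_of_nonneg_left (hLle z.2) (abs_nonneg _)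
      _ = N * (|p z.1 z.2| * w z.2) := by ring
  have hhint : Integrable h μ := hh1.add hh2
  set g : ℝ → ℝ := fun t => ∫ x, h (t, x) with hg
  have hgint : IntegrableOn g I (volume : Measure ℝ) := by
    have h' : Integrable h (((volume : Measure ℝ).restrict I).prod (volume : Measure E)) := by
      rwa [hμprod] at hhint
    exact h'.integral_prod_left
  -- MAIN STEP: `∫_I ξ g = 0` for every `ξ ∈ C_c^∞(I)`
  have hmain : ∀ ξ : ℝ → ℝ, ContDiff ℝ ∞ ξ → HasCompactSupport ξ → tsupport ξ ⊆ I →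
      ∫ t, ξ t • g t = 0 := by
    intro ξ hξ hξc hξI
    obtain ⟨Cξ, hCξ⟩ := hξ.continuous.bounded_above_of_compact_support hξc
    have hCξnn : 0 ≤ Cξ := le_trans (norm_nonneg _) (hCξ 0)
    have hξle : ∀ t, |ξ t| ≤ Cξ := fun t => by rw [← Real.norm_eq_abs]; exact hCξ t
    -- the scales `R_n = n + 1`, `c_n = 1 / (n + 1) → 0`
    set c : ℕ → ℝ := fun n => 1 / ((n : ℝ) + 1) with hc
    have hc0 : Tendsto c atTop (𝓝 0) := tendsto_one_div_add_atTop_nhds_zero_nat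
    have hcpos : ∀ n, 0 < c n := fun n => by rw [hc]; exact Nat.one_div_pos_of_nat
    have hcle : ∀ n, c n ≤ 1 := fun n => by
      rw [hc]
      simp only
      rw [div_le_one (by positivity)]
      have : (0 : ℝ) ≤ n := Nat.cast_nonneg n
      linarith
    -- the tested integrand at scale `R_n`, expanded
    set F : ℕ → ℝ × E → ℝ := fun n z =>
      ξ z.1 * (σ (c n • z.2) * D2 z.2 (u z.1 z.2) (u z.1 z.2) +
          2 * ((c n * fderiv ℝ σ (c n • z.2) (u z.1 z.2)) * D1 z.2 (u z.1 z.2)) +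
          Φ z.2 * (c n ^ 2 * fderiv ℝ (fderiv ℝ σ) (c n • z.2) (u z.1 z.2) (u z.1 z.2))) +
        p z.1 z.2 * (ξ z.1 * (σ (c n • z.2) * L z.2 +
          2 * ∑ i, (c n * fderiv ℝ σ (c n • z.2) (b i)) * D1 z.2 (b i) +
          Φ z.2 * (c n ^ 2 * Δ (σ : E → ℝ) (c n • z.2)))) with hF
    have hkey : ∀ n, ∫ z, F n z ∂μ = 0 := by
      intro n
      set s : E → ℝ := fun y => σ (c n • y) with hsdef
      have hs : ContDiff ℝ ∞ s := hσ.comp (contDiff_const_smul (c n))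
      have hs2 : ContDiff ℝ 2 s := contDiff_infty.1 hs 2
      have hsc : HasCompactSupport s := hσc.comp_smul (hcpos n).ne'
      have hθ' : FunctionSpaces.IsTestFunctionOn (⟨univ, isOpen_univ⟩ : Opens E)
          (fun y => s y * Φ y) :=
        ⟨hs.mul hΦ, hsc.mul_right, fun _ _ => mem_univ _⟩
      have hθ : IsSpaceTimeTestOn (slab E I hI) (fun t x => ξ t • (s x * Φ x)) :=
        isSpaceTimeTestOn_prod_smul hI isOpen_univ hξ hξc hξI hθ'
      have hf0 : LocallyIntegrableOn (uncurry (0 : ℝ → E → E))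
          ((slab E I hI : Opens (ℝ × E)) : Set (ℝ × E)) volume :=
        integrableOn_zero.locallyIntegrableOn
      have hdiv0 : ∀ φ : ℝ → E → ℝ, IsSpaceTimeTestOn (slab E I hI) φ →
          ∫ z in ((slab E I hI : Opens (ℝ × E)) : Set (ℝ × E)),
            ⟪(0 : ℝ → E → E) z.1 z.2, gradient (φ z.1) z.2⟫ = 0 := fun φ _ => by simp
      have key := hsol.integral_hessian_add_pressure_laplacian_eq_zero hf0 hdiv0 hθ
      rw [coe_slab] at key
      rw [← key]
      refine integral_congr_ae (Eventually.of_forall fun z => ?_)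
      have hsl : (fun x => ξ z.1 • (s x * Φ x)) = ξ z.1 • fun x => s x * Φ x := rfl
      simp only [hF]
      rw [hsl, Chae2011.fderiv_fderiv_const_smul, Chae2011.laplacian_const_smul, Pi.smul_apply]
      simp only [smul_apply, smul_eq_mul]
      rw [Chae2011.fderiv_fderiv_mul_apply hs2 hΦ2, Chae2011.laplacian_mul hs2 hΦ2, hsdef,
        Chae2011.fderiv_comp_smul_apply (σ : E → ℝ) (c n) z.2,
        Chae2011.fderiv_fderiv_comp_smul (σ : E → ℝ) (c n),
        Chae2011.laplacian_comp_smul (σ : E → ℝ) (c n) z.2]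
      simp only [smul_apply, smul_eq_mul, hD2, hD1, hL, hb]
    -- dominated convergence as `n → ∞`
    set Flim : ℝ × E → ℝ := fun z => ξ z.1 * h z with hFlim
    set bound : ℝ × E → ℝ := fun z =>
      Cξ * (‖u z.1 z.2‖ ^ 2 * w z.2 + 2 * (4 * K₁ * (‖u z.1 z.2‖ ^ 2 * (‖D1 z.2‖ / (1 + ‖z.2‖)))) +
          16 * K₂ * (‖u z.1 z.2‖ ^ 2 * (|Φ z.2| / (1 + ‖z.2‖) ^ 2))) +
        Cξ * (N * (|p z.1 z.2| * w z.2) + 2 * (N * (4 * K₁) * (|p z.1 z.2| * (‖D1 z.2‖ / (1 + ‖z.2‖)))) +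
          16 * (N * K₂) * (|p z.1 z.2| * (|Φ z.2| / (1 + ‖z.2‖) ^ 2))) with hbound
    have hbint : Integrable bound μ :=
      (((hI1'.add ((hI3'.const_mul _).const_mul _)).add (hI5'.const_mul _)).const_mul Cξ).add
        ((((hI2'.const_mul _).add ((hI4'.const_mul _).const_mul _)).add (hI6'.const_mul _)).const_mul Cξ)
    have hξm : AEStronglyMeasurable (fun z : ℝ × E => ξ z.1) μ :=
      (hξ.continuous.comp continuous_fst).aestronglyMeasurable
    have hσm : ∀ n, AEStronglyMeasurable (fun z : ℝ × E => σ (c n • z.2)) μ := fun n =>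
      ((σ.continuous.comp (continuous_snd.const_smul (c n))).aestronglyMeasurable)
    have hΦm : AEStronglyMeasurable (fun z : ℝ × E => Φ z.2) μ :=
      (hΦc.comp continuous_snd).aestronglyMeasurable
    have hFm : ∀ n, AEStronglyMeasurable (F n) μ := by
      intro n
      have m1 : AEStronglyMeasurable (fun z : ℝ × E => D2 z.2 (u z.1 z.2) (u z.1 z.2)) μ := by
        simpa using hmeasQ hAc 1
      have m2 : AEStronglyMeasurable
          (fun z : ℝ × E => fderiv ℝ σ (c n • z.2) (u z.1 z.2)) μ := hmeasLin hDσ1c (c n)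
      have m3 : AEStronglyMeasurable (fun z : ℝ × E => D1 z.2 (u z.1 z.2)) μ := by
        simpa using hmeasLin hA1c 1
      have m4 : AEStronglyMeasurable
          (fun z : ℝ × E => fderiv ℝ (fderiv ℝ σ) (c n • z.2) (u z.1 z.2) (u z.1 z.2)) μ :=
        hmeasQ hAσc (c n)
      have m5 : AEStronglyMeasurable (fun z : ℝ × E => L z.2) μ :=
        (hLc.comp continuous_snd).aestronglyMeasurable
      have m6 : AEStronglyMeasurable (fun z : ℝ × E =>
          ∑ i, (c n * fderiv ℝ σ (c n • z.2) (b i)) * D1 z.2 (b i)) μ :=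
        Finset.aestronglyMeasurable_fun_sum _ fun i _ =>
          ((((hDσ1c i).comp (continuous_snd.const_smul (c n))).aestronglyMeasurable.const_mul
            _).mul ((hA1c i).comp continuous_snd).aestronglyMeasurable)
      have m7 : AEStronglyMeasurable (fun z : ℝ × E => Δ (σ : E → ℝ) (c n • z.2)) μ :=
        (hΔσc.comp (continuous_snd.const_smul (c n))).aestronglyMeasurable
      exact (hξm.mul ((((hσm n).mul m1).add (((m2.const_mul _).mul m3).const_mul _)).add
        (hΦm.mul (m4.const_mul _)))).add
        (hpm'.mul (hξm.mul ((((hσm n).mul m5).add (m6.const_mul _)).add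
          (hΦm.mul (m7.const_mul _)))))
    -- pointwise bounds for the cut-off terms
    have hσD1 : ∀ n (x v : E), |c n * fderiv ℝ σ (c n • x) v| ≤ 4 * K₁ * ‖v‖ / (1 + ‖x‖) := by
      intro n x v
      by_cases h0 : fderiv ℝ σ (c n • x) = 0
      · rw [h0]
        simp only [zero_apply, mul_zero, abs_zero]
        positivity
      · have h1 : 1 ≤ ‖c n • x‖ := not_lt.1 fun hlt => h0 (hDσ_zero_in _ hlt)
        have h2 : ‖c n • x‖ ≤ 2 := not_lt.1 fun hlt => h0 (hDσ_zero_out _ hlt)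
        have hcx := hshell (c n) x (hcpos n) (hcle n) h1 h2
        rw [abs_mul, abs_of_pos (hcpos n)]
        have hv : |fderiv ℝ σ (c n • x) v| ≤ K₁ * ‖v‖ := hK₁ _ _
        calc c n * |fderiv ℝ σ (c n • x) v| ≤ (4 / (1 + ‖x‖)) * (K₁ * ‖v‖) :=
              mul_le_mul hcx hv (abs_nonneg _) (by positivity)
          _ = 4 * K₁ * ‖v‖ / (1 + ‖x‖) := by ring
    have hσD2 : ∀ n (x v : E), |c n ^ 2 * fderiv ℝ (fderiv ℝ σ) (c n • x) v v| ≤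
        16 * K₂ * ‖v‖ ^ 2 / (1 + ‖x‖) ^ 2 := by
      intro n x v
      by_cases h0 : fderiv ℝ (fderiv ℝ σ) (c n • x) = 0
      · rw [h0]
        simp only [zero_apply, mul_zero, abs_zero]
        positivity
      · have h1 : 1 ≤ ‖c n • x‖ := not_lt.1 fun hlt => h0 (hD2σ_zero_in _ hlt)
        have h2 : ‖c n • x‖ ≤ 2 := not_lt.1 fun hlt => h0 (hD2σ_zero_out _ hlt)
        have hcx := hshell (c n) x (hcpos n) (hcle n) h1 h2
        have hcx2 : c n ^ 2 ≤ 16 / (1 + ‖x‖) ^ 2 :=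
          calc c n ^ 2 ≤ (4 / (1 + ‖x‖)) ^ 2 := pow_le_pow_left₀ (hcpos n).le hcx 2
            _ = 16 / (1 + ‖x‖) ^ 2 := by rw [div_pow]; norm_num
        rw [abs_mul, abs_of_pos (pow_pos (hcpos n) 2)]
        calc c n ^ 2 * |fderiv ℝ (fderiv ℝ σ) (c n • x) v v|
            ≤ (16 / (1 + ‖x‖) ^ 2) * (K₂ * ‖v‖ ^ 2) :=
              mul_le_mul hcx2 (hK₂ _ _) (abs_nonneg _) (by positivity)
          _ = 16 * K₂ * ‖v‖ ^ 2 / (1 + ‖x‖) ^ 2 := by ring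
    have hσΔ : ∀ n (x : E), |c n ^ 2 * Δ (σ : E → ℝ) (c n • x)| ≤ 16 * (N * K₂) / (1 + ‖x‖) ^ 2 := by
      intro n x
      by_cases h0 : fderiv ℝ (fderiv ℝ σ) (c n • x) = 0
      · have : Δ (σ : E → ℝ) (c n • x) = 0 := by rw [hΔσfun]; simp [h0]
        rw [this, mul_zero, abs_zero]
        positivity
      · have h1 : 1 ≤ ‖c n • x‖ := not_lt.1 fun hlt => h0 (hD2σ_zero_in _ hlt)
        have h2 : ‖c n • x‖ ≤ 2 := not_lt.1 fun hlt => h0 (hD2σ_zero_out _ hlt)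
        have hcx := hshell (c n) x (hcpos n) (hcle n) h1 h2
        have hcx2 : c n ^ 2 ≤ 16 / (1 + ‖x‖) ^ 2 :=
          calc c n ^ 2 ≤ (4 / (1 + ‖x‖)) ^ 2 := pow_le_pow_left₀ (hcpos n).le hcx 2
            _ = 16 / (1 + ‖x‖) ^ 2 := by rw [div_pow]; norm_num
        rw [abs_mul, abs_of_pos (pow_pos (hcpos n) 2)]
        calc c n ^ 2 * |Δ (σ : E → ℝ) (c n • x)| ≤ (16 / (1 + ‖x‖) ^ 2) * (N * K₂) :=
              mul_le_mul hcx2 (hΔσle _) (abs_nonneg _) (by positivity)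
          _ = 16 * (N * K₂) / (1 + ‖x‖) ^ 2 := by ring
    have hsumD1 : ∀ n (x : E), |∑ i, (c n * fderiv ℝ σ (c n • x) (b i)) * D1 x (b i)| ≤
        N * (4 * K₁) * (‖D1 x‖ / (1 + ‖x‖)) := by
      intro n x
      refine (Finset.abs_sum_le_sum_abs _ _).trans ?_
      have hterm : ∀ i, |(c n * fderiv ℝ σ (c n • x) (b i)) * D1 x (b i)| ≤
          4 * K₁ * (‖D1 x‖ / (1 + ‖x‖)) := fun i => by
        rw [abs_mul]
        have h1 := hσD1 n x (b i)
        rw [b.orthonormal.1 i, mul_one] at h1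
        have h2 : |D1 x (b i)| ≤ ‖D1 x‖ := by
          rw [← Real.norm_eq_abs]
          have := (D1 x).le_opNorm (b i)
          rwa [b.orthonormal.1 i, mul_one] at this
        calc |c n * fderiv ℝ σ (c n • x) (b i)| * |D1 x (b i)| ≤ 4 * K₁ / (1 + ‖x‖) * ‖D1 x‖ :=
              mul_le_mul h1 h2 (abs_nonneg _) (by positivity)
          _ = 4 * K₁ * (‖D1 x‖ / (1 + ‖x‖)) := by ring
      calc ∑ i, |(c n * fderiv ℝ σ (c n • x) (b i)) * D1 x (b i)|
          ≤ ∑ _i : Fin (Module.finrank ℝ E), 4 * K₁ * (‖D1 x‖ / (1 + ‖x‖)) :=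
            Finset.sum_le_sum fun i _ => hterm i
        _ = N * (4 * K₁) * (‖D1 x‖ / (1 + ‖x‖)) := by
            simp only [Finset.sum_const, Finset.card_univ, Fintype.card_fin, nsmul_eq_mul, hN]
            ring
    have hFle : ∀ n, ∀ᵐ z ∂μ, ‖F n z‖ ≤ bound z := by
      intro n
      refine Eventually.of_forall fun z => ?_
      rw [Real.norm_eq_abs, hF, hbound]
      simp only
      -- velocity part
      have hA : |σ (c n • z.2) * D2 z.2 (u z.1 z.2) (u z.1 z.2)| ≤ ‖u z.1 z.2‖ ^ 2 * w z.2 := by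
        rw [abs_mul]
        calc |σ (c n • z.2)| * |D2 z.2 (u z.1 z.2) (u z.1 z.2)| ≤ 1 * (w z.2 * ‖u z.1 z.2‖ ^ 2) :=
              mul_le_mul (hσle _) (hw _ _) (abs_nonneg _) zero_le_one
          _ = ‖u z.1 z.2‖ ^ 2 * w z.2 := by ring
      have hB : |2 * ((c n * fderiv ℝ σ (c n • z.2) (u z.1 z.2)) * D1 z.2 (u z.1 z.2))| ≤
          2 * (4 * K₁ * (‖u z.1 z.2‖ ^ 2 * (‖D1 z.2‖ / (1 + ‖z.2‖)))) := by
        rw [abs_mul, abs_two, abs_mul]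
        refine mul_le_mul_of_nonneg_left ?_ zero_le_two
        have h1 := hσD1 n z.2 (u z.1 z.2)
        have h2 : |D1 z.2 (u z.1 z.2)| ≤ ‖D1 z.2‖ * ‖u z.1 z.2‖ := by
          rw [← Real.norm_eq_abs]; exact (D1 z.2).le_opNorm _
        calc |c n * fderiv ℝ σ (c n • z.2) (u z.1 z.2)| * |D1 z.2 (u z.1 z.2)|
            ≤ (4 * K₁ * ‖u z.1 z.2‖ / (1 + ‖z.2‖)) * (‖D1 z.2‖ * ‖u z.1 z.2‖) :=
              mul_le_mul h1 h2 (abs_nonneg _) (by positivity)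
          _ = 4 * K₁ * (‖u z.1 z.2‖ ^ 2 * (‖D1 z.2‖ / (1 + ‖z.2‖))) := by ring
      have hC : |Φ z.2 * (c n ^ 2 * fderiv ℝ (fderiv ℝ σ) (c n • z.2) (u z.1 z.2) (u z.1 z.2))| ≤
          16 * K₂ * (‖u z.1 z.2‖ ^ 2 * (|Φ z.2| / (1 + ‖z.2‖) ^ 2)) := by
        rw [abs_mul]
        calc |Φ z.2| * |c n ^ 2 * fderiv ℝ (fderiv ℝ σ) (c n • z.2) (u z.1 z.2) (u z.1 z.2)|
            ≤ |Φ z.2| * (16 * K₂ * ‖u z.1 z.2‖ ^ 2 / (1 + ‖z.2‖) ^ 2) :=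
              mul_le_mul_of_nonneg_left (hσD2 n z.2 _) (abs_nonneg _)
          _ = 16 * K₂ * (‖u z.1 z.2‖ ^ 2 * (|Φ z.2| / (1 + ‖z.2‖) ^ 2)) := by ring
      -- pressure part
      have hA' : |σ (c n • z.2) * L z.2| ≤ N * w z.2 := by
        rw [abs_mul]
        calc |σ (c n • z.2)| * |L z.2| ≤ 1 * (N * w z.2) :=
              mul_le_mul (hσle _) (hLle z.2) (abs_nonneg _) zero_le_one
          _ = N * w z.2 := one_mul _
      have hB' : |2 * ∑ i, (c n * fderiv ℝ σ (c n • z.2) (b i)) * D1 z.2 (b i)| ≤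
          2 * (N * (4 * K₁) * (‖D1 z.2‖ / (1 + ‖z.2‖))) := by
        rw [abs_mul, abs_two]
        exact mul_le_mul_of_nonneg_left (hsumD1 n z.2) zero_le_two
      have hC' : |Φ z.2 * (c n ^ 2 * Δ (σ : E → ℝ) (c n • z.2))| ≤
          16 * (N * K₂) * (|Φ z.2| / (1 + ‖z.2‖) ^ 2) := by
        rw [abs_mul]
        calc |Φ z.2| * |c n ^ 2 * Δ (σ : E → ℝ) (c n • z.2)|
            ≤ |Φ z.2| * (16 * (N * K₂) / (1 + ‖z.2‖) ^ 2) :=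
              mul_le_mul_of_nonneg_left (hσΔ n z.2) (abs_nonneg _)
          _ = 16 * (N * K₂) * (|Φ z.2| / (1 + ‖z.2‖) ^ 2) := by ring
      -- assemble
      have hvel := (abs_add_le _ _).trans (add_le_add ((abs_add_le _ _).trans (add_le_add hA hB)) hC)
      have hpre := (abs_add_le _ _).trans (add_le_add ((abs_add_le _ _).trans (add_le_add hA' hB')) hC')
      refine (abs_add_le _ _).trans (add_le_add ?_ ?_)
      · rw [abs_mul]
        exact mul_le_mul (hξle _) hvel (abs_nonneg _) hCξnn
      · rw [abs_mul, abs_mul]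
        calc |p z.1 z.2| * (|ξ z.1| * |σ (c n • z.2) * L z.2 +
              2 * ∑ i, (c n * fderiv ℝ σ (c n • z.2) (b i)) * D1 z.2 (b i) +
              Φ z.2 * (c n ^ 2 * Δ (σ : E → ℝ) (c n • z.2))|)
            ≤ |p z.1 z.2| * (Cξ * (N * w z.2 + 2 * (N * (4 * K₁) * (‖D1 z.2‖ / (1 + ‖z.2‖))) +
                16 * (N * K₂) * (|Φ z.2| / (1 + ‖z.2‖) ^ 2))) :=
              mul_le_mul_of_nonneg_left (mul_le_mul (hξle _) hpre (abs_nonneg _) hCξnn)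
                (abs_nonneg _)
          _ = Cξ * (N * (|p z.1 z.2| * w z.2) +
                2 * (N * (4 * K₁) * (|p z.1 z.2| * (‖D1 z.2‖ / (1 + ‖z.2‖)))) +
                16 * (N * K₂) * (|p z.1 z.2| * (|Φ z.2| / (1 + ‖z.2‖) ^ 2))) := by ring
    -- pointwise limit
    have hFlim_tendsto : ∀ᵐ z ∂μ, Tendsto (fun n => F n z) atTop (𝓝 (Flim z)) := by
      refine Eventually.of_forall fun z => ?_
      have hcz : Tendsto (fun n => c n • z.2) atTop (𝓝 0) := by
        simpa using hc0.smul_const z.2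
      have hσlim : Tendsto (fun n => σ (c n • z.2)) atTop (𝓝 1) := by
        have h1 := (σ.continuous.tendsto 0).comp hcz
        rwa [show σ (0 : E) = 1 from σ.one_of_mem_closedBall (by simp [σ.rIn_pos.le])] at h1
      have hD1lim : Tendsto (fun n => c n * fderiv ℝ σ (c n • z.2) (u z.1 z.2)) atTop (𝓝 0) := by
        have h1 : Tendsto (fun n => fderiv ℝ σ (c n • z.2) (u z.1 z.2)) atTop
            (𝓝 (fderiv ℝ σ 0 (u z.1 z.2))) := by
          rw [show (fun n => fderiv ℝ σ (c n • z.2) (u z.1 z.2)) = fun n =>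
              ∑ i, ⟪b i, u z.1 z.2⟫ * fderiv ℝ σ (c n • z.2) (b i) from
            funext fun n => Chae2011.apply_eq_sum _ _, Chae2011.apply_eq_sum (fderiv ℝ σ 0)]
          exact tendsto_finsetSum _ fun i _ => (((hDσ1c i).tendsto 0).comp hcz).const_mul _
        simpa using hc0.mul h1
      have hD2lim : Tendsto (fun n => c n ^ 2 * fderiv ℝ (fderiv ℝ σ) (c n • z.2) (u z.1 z.2)
          (u z.1 z.2)) atTop (𝓝 0) := by
        have h1 : Tendsto (fun n => fderiv ℝ (fderiv ℝ σ) (c n • z.2) (u z.1 z.2) (u z.1 z.2)) atTop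
            (𝓝 (fderiv ℝ (fderiv ℝ σ) 0 (u z.1 z.2) (u z.1 z.2))) := by
          rw [show (fun n => fderiv ℝ (fderiv ℝ σ) (c n • z.2) (u z.1 z.2) (u z.1 z.2)) = fun n =>
              ∑ i, ∑ j, (⟪b i, u z.1 z.2⟫ * ⟪b j, u z.1 z.2⟫) *
                fderiv ℝ (fderiv ℝ σ) (c n • z.2) (b i) (b j) from
            funext fun n => Chae2011.apply_apply_eq_sum _ _,
            Chae2011.apply_apply_eq_sum (fderiv ℝ (fderiv ℝ σ) 0)]
          exact tendsto_finsetSum _ fun i _ => tendsto_finsetSum _ fun j _ =>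
            (((hAσc i j).tendsto 0).comp hcz).const_mul _
        have h2 : Tendsto (fun n => c n ^ 2) atTop (𝓝 0) := by
          simpa using hc0.pow 2
        simpa using h2.mul h1
      have hsumlim : Tendsto (fun n => ∑ i, (c n * fderiv ℝ σ (c n • z.2) (b i)) * D1 z.2 (b i))
          atTop (𝓝 0) := by
        have : Tendsto (fun n => ∑ i, (c n * fderiv ℝ σ (c n • z.2) (b i)) * D1 z.2 (b i))
            atTop (𝓝 (∑ i : Fin (Module.finrank ℝ E), (0 * fderiv ℝ σ 0 (b i)) * D1 z.2 (b i))) :=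
          tendsto_finsetSum _ fun i _ =>
            ((hc0.mul (((hDσ1c i).tendsto 0).comp hcz)).mul_const _)
        simpa using this
      have hΔlim : Tendsto (fun n => c n ^ 2 * Δ (σ : E → ℝ) (c n • z.2)) atTop (𝓝 0) := by
        have h1 : Tendsto (fun n => Δ (σ : E → ℝ) (c n • z.2)) atTop (𝓝 (Δ (σ : E → ℝ) 0)) :=
          (hΔσc.tendsto 0).comp hcz
        have h2 : Tendsto (fun n => c n ^ 2) atTop (𝓝 0) := by simpa using hc0.pow 2
        simpa using h2.mul h1
      have hlim : Tendsto (fun n => F n z) atTop (𝓝 (ξ z.1 * (1 * D2 z.2 (u z.1 z.2) (u z.1 z.2) +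
          2 * (0 * D1 z.2 (u z.1 z.2)) + Φ z.2 * 0) +
          p z.1 z.2 * (ξ z.1 * (1 * L z.2 + 2 * 0 + Φ z.2 * 0)))) :=
        ((((hσlim.mul_const _).add ((hD1lim.mul_const _).const_mul _)).add
          (hD2lim.const_mul _)).const_mul _).add
          (((((hσlim.mul_const _).add (hsumlim.const_mul _)).add (hΔlim.const_mul _)).const_mul
            _).const_mul _)
      have e : ξ z.1 * (1 * D2 z.2 (u z.1 z.2) (u z.1 z.2) + 2 * (0 * D1 z.2 (u z.1 z.2)) + Φ z.2 * 0) +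
          p z.1 z.2 * (ξ z.1 * (1 * L z.2 + 2 * 0 + Φ z.2 * 0)) = Flim z := by
        simp only [hFlim, hh]
        ring
      rwa [e] at hlim
    have hDCT := tendsto_integral_of_dominated_convergence bound hFm hbint hFle hFlim_tendsto
    have hzero : Tendsto (fun n => ∫ z, F n z ∂μ) atTop (𝓝 0) := by
      simp_rw [hkey]; exact tendsto_const_nhds
    have hI0 : ∫ z, Flim z ∂μ = 0 := tendsto_nhds_unique hDCT hzero
    -- Fubini
    have hFlimInt : Integrable Flim μ := by
      refine (hhint.norm.const_mul Cξ).mono' (hξm.mul hhint.1) (Eventually.of_forall fun z => ?_)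
      rw [hFlim]
      simp only
      rw [norm_mul]
      exact mul_le_mul_of_nonneg_right (hCξ _) (norm_nonneg _)
    have hFlimInt' : Integrable Flim (((volume : Measure ℝ).restrict I).prod (volume : Measure E)) := by
      rwa [hμprod] at hFlimInt
    rw [hμprod, integral_prod _ hFlimInt'] at hI0
    have hinner : ∀ t, (∫ x, Flim (t, x)) = ξ t * g t := by
      intro t
      rw [hg, ← MeasureTheory.integral_const_mul]
    simp_rw [hinner] at hI0
    rw [← setIntegral_eq_integral_of_forall_compl_eq_zero (s := I) fun t ht => by
      rw [image_eq_zero_of_notMem_tsupport fun h' => ht (hξI h'), zero_smul]]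
    simpa only [smul_eq_mul] using hI0
  -- du Bois-Reymond in time
  have hae := hI.ae_eq_zero_of_integral_contDiff_smul_eq_zero
    (IntegrableOn.locallyIntegrableOn hgint) hmain
  have hae' : ∀ᵐ t ∂((volume : Measure ℝ).restrict I), g t = 0 :=
    (ae_restrict_iff' hI.measurableSet).2 hae
  -- split the slice integral
  have hh1' : Integrable (fun z : ℝ × E => D2 z.2 (u z.1 z.2) (u z.1 z.2))
      (((volume : Measure ℝ).restrict I).prod (volume : Measure E)) := by rwa [hμprod] at hh1
  have hh2' : Integrable (fun z : ℝ × E => p z.1 z.2 * L z.2)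
      (((volume : Measure ℝ).restrict I).prod (volume : Measure E)) := by rwa [hμprod] at hh2
  filter_upwards [hae', hh1'.prod_right_ae, hh2'.prod_right_ae] with t ht h1 h2
  rw [hg, hh] at ht
  simp only at ht
  rw [integral_add h1 h2] at ht
  exact ht

/-- **Weighted Liouville** (the conclusion scheme of Chae, arXiv:0811.4647, Thm 1.1: the velocity
terms are nonnegative because `w > 0`, the pressure term has a sign by hypothesis): under the
hypotheses of `ae_integral_hessian_apply_add_integral_pressure_mul_laplacian_eq_zero`, if the
weight is strictly convex in the quantitative form `κ(x)‖v‖² ≤ D²Φ(x)(v, v)` with `κ > 0`, and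
`∫ p(t,x) ΔΦ(x) dx ≥ 0` for a.e. `t`, then `u(t, ·) = 0` a.e. for a.e. `t ∈ I`.
[cite: Chae2008Weighted, Thm 1.1 (i)–(ii)] [cite: Chae2011, Thm 1.1 (i)] -/
theorem IsDistributionalNSSolutionOn.ae_slice_eq_zero_of_convex_weight
    (hsol : IsDistributionalNSSolutionOn (slab E I hI) ν 0 u p)
    {Φ : E → ℝ} (hΦ : ContDiff ℝ ∞ Φ) {w : E → ℝ}
    (hw : ∀ x v, |fderiv ℝ (fderiv ℝ Φ) x v v| ≤ w x * ‖v‖ ^ 2)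
    (hI1 : IntegrableOn (fun z : ℝ × E => ‖u z.1 z.2‖ ^ 2 * w z.2) (I ×ˢ univ) volume)
    (hI2 : IntegrableOn (fun z : ℝ × E => |p z.1 z.2| * w z.2) (I ×ˢ univ) volume)
    (hI3 : IntegrableOn (fun z : ℝ × E => ‖u z.1 z.2‖ ^ 2 * (‖fderiv ℝ Φ z.2‖ / (1 + ‖z.2‖)))
      (I ×ˢ univ) volume)
    (hI4 : IntegrableOn (fun z : ℝ × E => |p z.1 z.2| * (‖fderiv ℝ Φ z.2‖ / (1 + ‖z.2‖)))
      (I ×ˢ univ) volume)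
    (hI5 : IntegrableOn (fun z : ℝ × E => ‖u z.1 z.2‖ ^ 2 * (|Φ z.2| / (1 + ‖z.2‖) ^ 2))
      (I ×ˢ univ) volume)
    (hI6 : IntegrableOn (fun z : ℝ × E => |p z.1 z.2| * (|Φ z.2| / (1 + ‖z.2‖) ^ 2))
      (I ×ˢ univ) volume)
    {κ : E → ℝ} (hκ : ∀ x, 0 < κ x)
    (hconv : ∀ x v, κ x * ‖v‖ ^ 2 ≤ fderiv ℝ (fderiv ℝ Φ) x v v)
    (hsign : ∀ᵐ t ∂(volume.restrict I), 0 ≤ ∫ x, p t x * Δ Φ x) :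
    ∀ᵐ t ∂(volume.restrict I), (fun x => u t x) =ᵐ[volume] 0 := by
  -- slice integrability of the velocity integrand (from `hI1` through the product structure)
  set μ : Measure (ℝ × E) := (volume : Measure (ℝ × E)).restrict (I ×ˢ (univ : Set E)) with hμ
  have hμprod : μ = ((volume : Measure ℝ).restrict I).prod (volume : Measure E) := by
    rw [hμ]
    conv_rhs => rw [← Measure.restrict_univ (μ := (volume : Measure E))]
    rw [Measure.prod_restrict, ← Measure.volume_eq_prod]
  have hum : AEStronglyMeasurable (uncurry u) μ := by
    have h := hsol.1.aestronglyMeasurable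
    rwa [coe_slab] at h
  set b := stdOrthonormalBasis ℝ E with hb
  have hΦ3 : ContDiff ℝ 3 Φ := contDiff_infty.1 hΦ 3
  have hD2c := (hΦ3.fderiv_right (m := 2) le_rfl).continuous_fderiv (by simp)
  have hAc : ∀ i j, Continuous fun y => fderiv ℝ (fderiv ℝ Φ) y (b i) (b j) := fun i j =>
    (hD2c.clm_apply continuous_const).clm_apply continuous_const
  have hmeas : AEStronglyMeasurable
      (fun z : ℝ × E => fderiv ℝ (fderiv ℝ Φ) z.2 (u z.1 z.2) (u z.1 z.2)) μ := by
    have e : (fun z : ℝ × E => fderiv ℝ (fderiv ℝ Φ) z.2 (u z.1 z.2) (u z.1 z.2)) = fun z =>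
        ∑ i, ∑ j, (⟪b i, u z.1 z.2⟫ * ⟪b j, u z.1 z.2⟫) * fderiv ℝ (fderiv ℝ Φ) z.2 (b i) (b j) :=
      funext fun z => Chae2011.apply_apply_eq_sum _ _
    rw [e]
    refine Finset.aestronglyMeasurable_fun_sum _ fun i _ =>
      Finset.aestronglyMeasurable_fun_sum _ fun j _ => ?_
    exact ((aestronglyMeasurable_const.inner hum).mul (aestronglyMeasurable_const.inner hum)).mul
      (((hAc i j).comp continuous_snd).aestronglyMeasurable)
  have hI1' : Integrable (fun z : ℝ × E => ‖u z.1 z.2‖ ^ 2 * w z.2) μ := hI1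
  have hh1 : Integrable (fun z : ℝ × E => fderiv ℝ (fderiv ℝ Φ) z.2 (u z.1 z.2) (u z.1 z.2)) μ := by
    refine hI1'.mono' hmeas (Eventually.of_forall fun z => ?_)
    rw [Real.norm_eq_abs, mul_comm]
    exact hw _ _
  have hh1' : Integrable (fun z : ℝ × E => fderiv ℝ (fderiv ℝ Φ) z.2 (u z.1 z.2) (u z.1 z.2))
      (((volume : Measure ℝ).restrict I).prod (volume : Measure E)) := by rwa [hμprod] at hh1
  filter_upwards [hsol.ae_integral_hessian_apply_add_integral_pressure_mul_laplacian_eq_zero hΦ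
    hw hI1 hI2 hI3 hI4 hI5 hI6, hsign, hh1'.prod_right_ae] with t ht hs hint
  -- `∫ D²Φ(u,u) = -∫ p ΔΦ ≤ 0` with an integrand `≥ κ|u|² ≥ 0`
  have hle : ∫ x, fderiv ℝ (fderiv ℝ Φ) x (u t x) (u t x) ≤ 0 := by linarith
  have hnn : 0 ≤ᵐ[volume] fun x => fderiv ℝ (fderiv ℝ Φ) x (u t x) (u t x) :=
    Eventually.of_forall fun x => le_trans (mul_nonneg (hκ x).le (sq_nonneg _)) (hconv x (u t x))
  have h0 : (fun x => fderiv ℝ (fderiv ℝ Φ) x (u t x) (u t x)) =ᵐ[volume] 0 :=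
    (integral_eq_zero_iff_of_nonneg_ae hnn hint).1 (le_antisymm hle (integral_nonneg_of_ae hnn))
  filter_upwards [h0] with x hx
  have h1 : κ x * ‖u t x‖ ^ 2 ≤ 0 := by
    have := hconv x (u t x)
    simp only [Pi.zero_apply] at hx
    linarith
  have h2 : ‖u t x‖ ^ 2 ≤ 0 := by
    by_contra hne
    push Not at hne
    have := mul_pos (hκ x) hne
    linarith
  have h3 : ‖u t x‖ = 0 := by nlinarith [norm_nonneg (u t x)]
  simpa using h3

/-- **Chae 2008, Theorem 1.2, for the admissible weight `w(r) = (1 + r²)^{-3/2}`** (so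
`W(r) = √(1+r²) − 1`, `W'(r)/r = (1+r²)^{-1/2}`; (18): `0 < w(r) ≤ C/(1+r)`, `w ∈ L¹(0, ∞)`).
"Let `(v, p)` be a weak solution to `(NS)_ν` … such that `∫₀ᵀ∫ (|v|² + |p|)/(1+|x|) dx dt < ∞` (16)
… Suppose … `∫ p(x,t)[w(|x|) + (N−1)|x|⁻¹∫₀^{|x|} w(s) ds] dx ≥ 0` (17). Then `v(x,t) = 0` almost
everywhere on `ℝᴺ × (0, T)`."  Here: on any slab `I × E`, if `|u|²/(1+|x|)` and `|p|/(1+|x|)` are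
integrable and `∫ p(t,x) [(N−1)(1+|x|²)^{-1/2} + (1+|x|²)^{-3/2}] dx ≥ 0` for a.e. `t`, then
`u(t, ·) = 0` a.e. for a.e. `t ∈ I` — `ae_slice_eq_zero_of_convex_weight` with `Φ(x) = ⟨x⟩ :=
√(1+|x|²)`, `D²Φ(x)(v,v) = |v|²/⟨x⟩ − ⟨x,v⟩²/⟨x⟩³ ∈ [|v|²/⟨x⟩³, |v|²/⟨x⟩]`,
`ΔΦ = (N−1)/⟨x⟩ + 1/⟨x⟩³`. [cite: Chae2008Weighted, Thm 1.2 (16), (17), (18)] -/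
theorem chae2008_thm12_bracketWeight
    (hsol : IsDistributionalNSSolutionOn (slab E I hI) ν 0 u p)
    (hu : IntegrableOn (fun z : ℝ × E => ‖u z.1 z.2‖ ^ 2 / (1 + ‖z.2‖)) (I ×ˢ univ) volume)
    (hp : IntegrableOn (fun z : ℝ × E => |p z.1 z.2| / (1 + ‖z.2‖)) (I ×ˢ univ) volume)
    (hsign : ∀ᵐ t ∂(volume.restrict I), 0 ≤ ∫ x, p t x *
      (((Module.finrank ℝ E : ℝ) - 1) / √(1 + ‖x‖ ^ 2) + 1 / √(1 + ‖x‖ ^ 2) ^ 3)) :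
    ∀ᵐ t ∂(volume.restrict I), (fun x => u t x) =ᵐ[volume] 0 := by
  set b := stdOrthonormalBasis ℝ E with hb
  set Φ : E → ℝ := fun x => √(1 + ‖x‖ ^ 2) with hΦdef
  have hqpos : ∀ x : E, 0 < 1 + ‖x‖ ^ 2 := fun x => by positivity
  have hΦpos : ∀ x, 0 < Φ x := fun x => Real.sqrt_pos.2 (hqpos x)
  have hΦsq : ∀ x, Φ x ^ 2 = 1 + ‖x‖ ^ 2 := fun x => Real.sq_sqrt (hqpos x).le
  have hΦge : ∀ x, ‖x‖ ≤ Φ x := fun x => by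
    rw [← Real.sqrt_sq (norm_nonneg x)]
    exact Real.sqrt_le_sqrt (by linarith)
  have hΦge1 : ∀ x, 1 ≤ Φ x := fun x => by
    have h := hΦsq x
    nlinarith [sq_nonneg ‖x‖, (hΦpos x).le]
  have hΦle : ∀ x, Φ x ≤ 1 + ‖x‖ := fun x => by
    rw [show Φ x = √(1 + ‖x‖ ^ 2) from rfl, Real.sqrt_le_left (by positivity)]
    nlinarith [norm_nonneg x]
  have hΦle2 : ∀ x, 1 + ‖x‖ ≤ 2 * Φ x := fun x => by
    nlinarith [hΦge x, hΦge1 x, norm_nonneg x]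
  -- smoothness and the first two derivatives of `Φ`
  have hΦsmooth : ContDiff ℝ ∞ Φ :=
    (contDiff_const.add (contDiff_norm_sq ℝ)).sqrt fun x => (hqpos x).ne'
  have hq : ∀ x : E, HasFDerivAt (fun y : E => 1 + ‖y‖ ^ 2) ((2 : ℝ) • innerSL ℝ x) x :=
    fun x => (((hasStrictFDerivAt_norm_sq x).hasFDerivAt).const_add 1).congr_fderiv
      (by rw [two_smul, two_smul])
  have hΦ' : ∀ x, HasFDerivAt Φ ((Φ x)⁻¹ • innerSL ℝ x) x := fun x => by
    have h := (hq x).sqrt (hqpos x).ne'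
    rw [smul_smul] at h
    convert h using 2
    rw [show √(1 + ‖x‖ ^ 2) = Φ x from rfl]
    field_simp
  have hD1 : fderiv ℝ Φ = fun x => (Φ x)⁻¹ • innerSL ℝ x := funext fun x => (hΦ' x).fderiv
  have hinv : ∀ x, HasFDerivAt (fun y => (Φ y)⁻¹) ((-(Φ x ^ 2)⁻¹) • ((Φ x)⁻¹ • innerSL ℝ x)) x :=
    fun x => (hasDerivAt_inv (hΦpos x).ne').comp_hasFDerivAt x (hΦ' x)
  have hG : ∀ x, HasFDerivAt (fun y => (Φ y)⁻¹ • innerSL ℝ y)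
      ((Φ x)⁻¹ • (innerSL ℝ : E →L[ℝ] E →L[ℝ] ℝ) +
        ((-(Φ x ^ 2)⁻¹) • ((Φ x)⁻¹ • innerSL ℝ x)).smulRight (innerSL ℝ x)) x :=
    fun x => (hinv x).fun_smul (innerSL ℝ : E →L[ℝ] E →L[ℝ] ℝ).hasFDerivAt
  have hD2v : ∀ x v, fderiv ℝ (fderiv ℝ Φ) x v v = ‖v‖ ^ 2 / Φ x - ⟪x, v⟫ ^ 2 / Φ x ^ 3 := by
    intro x v
    rw [hD1, (hG x).fderiv]
    simp only [add_apply, smul_apply, ContinuousLinearMap.smulRight_apply, innerSL_apply_apply,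
      smul_eq_mul]
    have hv : ((innerSL ℝ : E →L[ℝ] E →L[ℝ] ℝ) v) v = ‖v‖ ^ 2 := by
      rw [← real_inner_self_eq_norm_sq]
      rfl
    rw [hv]
    field_simp
    ring
  -- two-sided bounds of the Hessian and the Laplacian
  have hcs : ∀ x v : E, ⟪x, v⟫ ^ 2 ≤ ‖x‖ ^ 2 * ‖v‖ ^ 2 := fun x v => by
    rw [← mul_pow, ← sq_abs]
    exact pow_le_pow_left₀ (abs_nonneg _) (abs_real_inner_le_norm x v) 2
  have hupper : ∀ x v, fderiv ℝ (fderiv ℝ Φ) x v v ≤ ‖v‖ ^ 2 / Φ x := fun x v => by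
    rw [hD2v]
    have : 0 ≤ ⟪x, v⟫ ^ 2 / Φ x ^ 3 := by positivity
    linarith
  have hlower : ∀ x v, (Φ x ^ 3)⁻¹ * ‖v‖ ^ 2 ≤ fderiv ℝ (fderiv ℝ Φ) x v v := fun x v => by
    rw [hD2v]
    have h3 : 0 < Φ x ^ 3 := pow_pos (hΦpos x) 3
    have h1 : ⟪x, v⟫ ^ 2 / Φ x ^ 3 ≤ ‖x‖ ^ 2 * ‖v‖ ^ 2 / Φ x ^ 3 :=
      div_le_div_of_nonneg_right (hcs x v) h3.le
    have h2 : ‖v‖ ^ 2 / Φ x - ‖x‖ ^ 2 * ‖v‖ ^ 2 / Φ x ^ 3 = (Φ x ^ 3)⁻¹ * ‖v‖ ^ 2 := by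
      field_simp
      rw [show Φ x ^ 3 = Φ x * Φ x ^ 2 from by ring, hΦsq]
      ring
    linarith
  have hw : ∀ x v, |fderiv ℝ (fderiv ℝ Φ) x v v| ≤ (Φ x)⁻¹ * ‖v‖ ^ 2 := fun x v => by
    rw [abs_le]
    constructor
    · have h0 : 0 ≤ (Φ x ^ 3)⁻¹ * ‖v‖ ^ 2 := by positivity
      have h0' : 0 ≤ (Φ x)⁻¹ * ‖v‖ ^ 2 := by positivity
      linarith [hlower x v]
    · rw [← div_eq_inv_mul]
      exact hupper x v
  have hΔ : ∀ x, Δ Φ x = ((Module.finrank ℝ E : ℝ) - 1) / √(1 + ‖x‖ ^ 2) +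
      1 / √(1 + ‖x‖ ^ 2) ^ 3 := fun x => by
    rw [Chae2011.laplacian_eq_sum_fderiv_fderiv]
    simp only [hD2v]
    rw [Finset.sum_sub_distrib, ← Finset.sum_div, ← Finset.sum_div]
    simp only [OrthonormalBasis.norm_eq_one, one_pow, Finset.sum_const, Finset.card_univ,
      Fintype.card_fin, nsmul_eq_mul, mul_one]
    rw [(stdOrthonormalBasis ℝ E).sum_sq_inner_left, show √(1 + ‖x‖ ^ 2) = Φ x from rfl]
    have h3 : Φ x ^ 3 = Φ x * (1 + ‖x‖ ^ 2) := by
      rw [show Φ x ^ 3 = Φ x * Φ x ^ 2 from by ring, hΦsq]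
    rw [h3]
    field_simp
    ring
  -- the six growth conditions from `|u|²/(1+|x|), |p|/(1+|x|) ∈ L¹`
  set μ : Measure (ℝ × E) := (volume : Measure (ℝ × E)).restrict (I ×ˢ (univ : Set E)) with hμ
  have hum : AEStronglyMeasurable (fun z : ℝ × E => u z.1 z.2) μ := by
    have h := hsol.1.aestronglyMeasurable
    rwa [coe_slab] at h
  have hpm : AEStronglyMeasurable (fun z : ℝ × E => p z.1 z.2) μ := by
    have h := hsol.2.2.1.aestronglyMeasurable
    rwa [coe_slab] at h
  have hu' : Integrable (fun z : ℝ × E => ‖u z.1 z.2‖ ^ 2 / (1 + ‖z.2‖)) μ := hu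
  have hp' : Integrable (fun z : ℝ × E => |p z.1 z.2| / (1 + ‖z.2‖)) μ := hp
  have hΦc : Continuous Φ := hΦsmooth.continuous
  have hD1c : Continuous (fderiv ℝ Φ) := (contDiff_infty.1 hΦsmooth 1).continuous_fderiv (by simp)
  -- generic domination: a continuous factor `ρ` with `|ρ(x)| ≤ C/(1+|x|)`
  have hdomu : ∀ {ρ : E → ℝ}, Continuous ρ → ∀ C : ℝ, (∀ x, |ρ x| ≤ C / (1 + ‖x‖)) →
      Integrable (fun z : ℝ × E => ‖u z.1 z.2‖ ^ 2 * ρ z.2) μ := by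
    intro ρ hρ C hC
    refine (hu'.const_mul C).mono' ((hum.norm.pow 2).mul (hρ.comp continuous_snd).aestronglyMeasurable)
      (Eventually.of_forall fun z => ?_)
    rw [norm_mul, Real.norm_eq_abs, Real.norm_eq_abs, abs_of_nonneg (by positivity)]
    calc ‖u z.1 z.2‖ ^ 2 * |ρ z.2| ≤ ‖u z.1 z.2‖ ^ 2 * (C / (1 + ‖z.2‖)) :=
          mul_le_mul_of_nonneg_left (hC z.2) (by positivity)
      _ = C * (‖u z.1 z.2‖ ^ 2 / (1 + ‖z.2‖)) := by ring
  have hdomp : ∀ {ρ : E → ℝ}, Continuous ρ → ∀ C : ℝ, (∀ x, |ρ x| ≤ C / (1 + ‖x‖)) →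
      Integrable (fun z : ℝ × E => |p z.1 z.2| * ρ z.2) μ := by
    intro ρ hρ C hC
    refine (hp'.const_mul C).mono' ((hpm.norm).mul (hρ.comp continuous_snd).aestronglyMeasurable
      |>.congr (Eventually.of_forall fun z => by simp [Real.norm_eq_abs]))
      (Eventually.of_forall fun z => ?_)
    rw [norm_mul, Real.norm_eq_abs, Real.norm_eq_abs, abs_abs]
    calc |p z.1 z.2| * |ρ z.2| ≤ |p z.1 z.2| * (C / (1 + ‖z.2‖)) :=
          mul_le_mul_of_nonneg_left (hC z.2) (abs_nonneg _)
      _ = C * (|p z.1 z.2| / (1 + ‖z.2‖)) := by ring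
  -- the three continuous factors and their bounds
  have hρ1c : Continuous fun x => (Φ x)⁻¹ := hΦc.inv₀ fun x => (hΦpos x).ne'
  have hρ1 : ∀ x, |(Φ x)⁻¹| ≤ 2 / (1 + ‖x‖) := fun x => by
    rw [abs_of_pos (inv_pos.2 (hΦpos x)), inv_eq_one_div,
      div_le_div_iff₀ (hΦpos x) (by positivity)]
    linarith [hΦle2 x]
  have hρ2c : Continuous fun x => ‖fderiv ℝ Φ x‖ / (1 + ‖x‖) :=
    (hD1c.norm).div (continuous_const.add continuous_norm) fun x => by positivity
  have hρ2 : ∀ x, |‖fderiv ℝ Φ x‖ / (1 + ‖x‖)| ≤ 1 / (1 + ‖x‖) := fun x => by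
    rw [abs_of_nonneg (by positivity)]
    refine div_le_div_of_nonneg_right ?_ (by positivity)
    rw [hD1]
    simp only
    rw [norm_smul, norm_inv, Real.norm_eq_abs, abs_of_pos (hΦpos x), innerSL_apply_norm]
    rw [inv_mul_le_iff₀ (hΦpos x), mul_one]
    exact hΦge x
  have hρ3c : Continuous fun x => |Φ x| / (1 + ‖x‖) ^ 2 :=
    (hΦc.abs).div ((continuous_const.add continuous_norm).pow 2) fun x => by positivity
  have hρ3 : ∀ x, |(|Φ x| / (1 + ‖x‖) ^ 2)| ≤ 1 / (1 + ‖x‖) := fun x => by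
    rw [abs_of_nonneg (by positivity), abs_of_pos (hΦpos x),
      div_le_div_iff₀ (by positivity) (by positivity)]
    calc Φ x * (1 + ‖x‖) ≤ (1 + ‖x‖) * (1 + ‖x‖) :=
          mul_le_mul_of_nonneg_right (hΦle x) (by positivity)
      _ = 1 * (1 + ‖x‖) ^ 2 := by ring
  have hzero := hsol.ae_slice_eq_zero_of_convex_weight hΦsmooth hw
    (hdomu hρ1c 2 hρ1) (hdomp hρ1c 2 hρ1) (hdomu hρ2c 1 hρ2) (hdomp hρ2c 1 hρ2)
    (hdomu hρ3c 1 hρ3) (hdomp hρ3c 1 hρ3) (κ := fun x => (Φ x ^ 3)⁻¹)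
    (fun x => inv_pos.2 (pow_pos (hΦpos x) 3)) hlower
  refine hzero ?_
  filter_upwards [hsign] with t ht
  rwa [show (fun x => p t x * Δ Φ x) = fun x => p t x *
      (((Module.finrank ℝ E : ℝ) - 1) / √(1 + ‖x‖ ^ 2) + 1 / √(1 + ‖x‖ ^ 2) ^ 3) from
    funext fun x => by rw [hΔ]]

end Weighted

end Literature.Analysis.FluidPDE
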